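import Literature.Analysis.PDE.HeatZeroInitialDuhamel
import Literature.Analysis.PDE.FreeFlowSlabSmooth
import Literature.Analysis.FluidPDE.HeatDuhamelEnergy
import Literature.Analysis.FluidPDE.WholeSpaceIBP
import HarnessLib

/-!
# Time-weighted energy identities and estimates for the zero-initial-value Duhamel solution
# (topic `Analysis/PDE`)

Analytic layer of the programme to prove short-time existence for quasilinear strictly
parabolic systems on a closed manifold (hypothesis `hQL` of
`Literature.Geometry.Riemannian.ricciFlow_shortTime_existence_of_quasilinear`). The linear
theory of that programme is built by a Neumann series whose convergence at EVERY Sobolev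
order on ONE time interval requires estimates in the time-weighted norms
`∫₀ᵀ e^{-2λt} E_k(·) dt` (`λ` large absorbs all lower-order terms; the top-order terms are
controlled by the `λ`-independent maximal-regularity constant). This file proves these
weighted estimates for the zero-initial-value solution `v = heatDuhamelZero ν Θ` of
`∂ₜv = νΔv + Θ`, `v(0) = 0` (`HeatZeroInitialDuhamel.lean`), reading the data `Θ` ONLY on the
interval `[0, t]` (so that the extension of the data to negative times that enters the
definition of `v` plays no quantitative role):

* the **weighted energy identity** (`weighted_energy_identity_heatDuhamelZero`):
  `e^{-2λt}‖v(t)‖₂² + 2λ ∫₀ᵗ e^{-2λs}‖v‖₂² + 2ν ∫₀ᵗ e^{-2λs} Σᵢ‖∂ᵢv‖₂² = 2 ∫₀ᵗ e^{-2λs}⟨v, Θ⟩`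
  for every real `λ` (for `λ = 0` the classical energy identity), proved pointwise in `x`
  (`d/ds (e^{-2λs}|v|²) = e^{-2λs}(2⟪v, νΔv + Θ⟫ - 2λ|v|²)`, one-sided at `s = 0`), then
  integrated in `x` with Fubini on the slab and the boundary-free integration by parts
  `∫⟪v, Δv⟫ = -Σᵢ‖∂ᵢv‖₂²`;
* the **weighted energy inequality** (`weighted_energy_le_heatDuhamelZero`), `λ > 0`:
  `e^{-2λt}‖v(t)‖₂² + λ ∫₀ᵗ e^{-2λs}‖v‖₂² + 2ν ∫₀ᵗ e^{-2λs}Σᵢ‖∂ᵢv‖₂² ≤ λ⁻¹ ∫₀ᵗ e^{-2λs}‖Θ‖₂²`;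
* the **weighted maximal-regularity inequality** (`weighted_gradient_energy_le_heatDuhamelZero`):
  `e^{-2λt}Σᵢ‖∂ᵢv(t)‖₂² + 2λ ∫₀ᵗ e^{-2λs}Σᵢ‖∂ᵢv‖₂² + ν ∫₀ᵗ e^{-2λs}Σᵢⱼ‖∂ⱼ∂ᵢv‖₂²
   ≤ (n/ν) ∫₀ᵗ e^{-2λs}‖Θ‖₂²` (`n = dim E`; the identity for the data `∂ᵢΘ`, summed, and
  `Σᵢ⟨∂ᵢv, ∂ᵢΘ⟩ = -⟨Δv, Θ⟩`, `‖Δv‖₂² ≤ n Σᵢⱼ‖∂ⱼ∂ᵢv‖₂²`).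

On the way: uniform bounds, integrability and joint continuity of `v` and of the free flow,
and the slab integrability of the pairings of such fields.

Everything is proved; no named fact and no `sorry` is introduced.

## References

* L. C. Evans, *Partial Differential Equations*, 2nd ed., AMS 2010, §7.1.2, Thm. 2 (energy
  estimates for linear parabolic equations; the weight `e^{-λt}` is the device of §7.1.2 (b),
  proof of Thm. 2, and of the Gronwall step in §7.1.3). [Evans2010]
* P. G. Lemarié-Rieusset, *The Navier–Stokes problem in the 21st century*, CRC Press 2016,
  Prop. 4.3 (B), (C), pp. 74–75 (the unweighted identities). [LemarieRieusset2016]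
-/

noncomputable section

open MeasureTheory Set Function Filter Topology TopologicalSpace Metric InnerProductSpace
open scoped RealInnerProductSpace Laplacian ContDiff ENNReal

namespace Literature.Analysis.PDE

open Literature.Analysis.UnboundedOperators Literature.Analysis.FluidPDE
  Literature.Analysis.FunctionSpaces

variable {E : Type*} [NormedAddCommGroup E] [InnerProductSpace ℝ E] [FiniteDimensional ℝ E]
  [MeasurableSpace E] [BorelSpace E]
variable {F' : Type*} [NormedAddCommGroup F'] [InnerProductSpace ℝ F'] [FiniteDimensional ℝ F']

variable {ν : ℝ} {Θ Θ₁ Θ₂ : ℝ → E → F'}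

/-! ### Uniform bounds and integrability of the forward Duhamel integral -/

section Forward

omit [FiniteDimensional ℝ F'] in
/-- The forward Duhamel integral is the time-reversed backward one (function form).
[folklore] -/
theorem heatDuhamelFwd_eq_heatDuhamelBack (ν : ℝ) (Θ : ℝ → E → F') (t : ℝ) :
    heatDuhamelFwd ν Θ t = heatDuhamelBack ν (timeReverse Θ) (-t) := rfl

omit [FiniteDimensional ℝ F'] in
/-- **Uniform bound below a time**: `‖𝒱[Θ](t)(x)‖ ≤ C` for all `t ≤ T` and all `x`.
[folklore] -/
theorem exists_norm_heatDuhamelFwd_le (hΘ : IsSpaceTimeTestOn (⊤ : Opens (ℝ × E)) Θ)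
    (hν : 0 < ν) (T : ℝ) :
    ∃ C : ℝ, 0 ≤ C ∧ ∀ t, t ≤ T → ∀ x, ‖heatDuhamelFwd ν Θ t x‖ ≤ C := by
  have hΘr := isSpaceTimeTestOn_timeReverse hΘ
  obtain ⟨M, hM0, hM⟩ := hΘr.exists_norm_le
  obtain ⟨a, b, hab⟩ := hΘr.exists_time_support
  refine ⟨M * max (b + T) 0, by positivity, fun t ht x ↦ ?_⟩
  rw [heatDuhamelFwd_eq_heatDuhamelBack]
  refine (hΘr.norm_heatDuhamelBack_le hν hM hab (-t) x).trans ?_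
  refine mul_le_mul_of_nonneg_left (max_le_max (by linarith) le_rfl) hM0

/-- The slices of the forward Duhamel integral are integrable. [folklore] -/
theorem integrable_heatDuhamelFwd (hΘ : IsSpaceTimeTestOn (⊤ : Opens (ℝ × E)) Θ) (hν : 0 < ν)
    (t : ℝ) : Integrable (heatDuhamelFwd ν Θ t) volume := by
  haveI : CompleteSpace F' := FiniteDimensional.complete ℝ F'
  rw [heatDuhamelFwd_eq_heatDuhamelBack]
  exact (isSpaceTimeTestOn_timeReverse hΘ).integrable_heatDuhamelBack hν (-t)

omit [FiniteDimensional ℝ F'] in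
/-- **Uniform `L¹` bound below a time**: `∫‖𝒱[Θ](t)‖ ≤ C` for all `t ≤ T`. [folklore] -/
theorem exists_integral_norm_heatDuhamelFwd_le [CompleteSpace F']
    (hΘ : IsSpaceTimeTestOn (⊤ : Opens (ℝ × E)) Θ) (hν : 0 < ν) (T : ℝ) :
    ∃ C : ℝ, 0 ≤ C ∧ ∀ t, t ≤ T → ∫ x, ‖heatDuhamelFwd ν Θ t x‖ ≤ C := by
  have hΘr := isSpaceTimeTestOn_timeReverse hΘ
  obtain ⟨M₁, hM₁0, hM₁⟩ := hΘr.exists_integral_norm_slice_le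
  obtain ⟨a, b, hab⟩ := hΘr.exists_time_support
  refine ⟨M₁ * max (b + T) 0, by positivity, fun t ht ↦ ?_⟩
  rw [heatDuhamelFwd_eq_heatDuhamelBack]
  refine (hΘr.integral_norm_heatDuhamelBack_le hν hM₁ hab (-t)).trans ?_
  exact mul_le_mul_of_nonneg_left (max_le_max (by linarith) le_rfl) hM₁0

end Forward

/-! ### The free flow: bounds, integrability, joint continuity -/

section FreeFlow

variable {h : E → F'}

omit [FiniteDimensional ℝ F'] in
/-- The free flow of bounded data is bounded by the same constant. [folklore] -/
theorem norm_freeFlow_le {C : ℝ} (hC : ∀ z, ‖h z‖ ≤ C) (hν : 0 < ν) (t : ℝ) (x : E) :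
    ‖freeFlow ν h t x‖ ≤ C := by
  rcases le_or_gt t 0 with ht | ht
  · rw [freeFlow_of_nonpos ν h ht]; exact hC x
  · rw [freeFlow_of_pos ν h ht]; exact norm_heatExtension_le hC (mul_pos hν ht) x

omit [FiniteDimensional ℝ F'] in
/-- The free flow of integrable data is integrable. [folklore] -/
theorem integrable_freeFlow [CompleteSpace F'] (hh : Integrable h volume) (hν : 0 < ν) (t : ℝ) :
    Integrable (freeFlow ν h t) volume := by
  rcases le_or_gt t 0 with ht | ht
  · rw [freeFlow_of_nonpos ν h ht]; exact hh
  · rw [freeFlow_of_pos ν h ht]; exact integrable_heatExtension hh (mul_pos hν ht)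

omit [FiniteDimensional ℝ F'] in
/-- **`L¹` contraction of the free flow**: `∫‖e^{νtΔ}h‖ ≤ ∫‖h‖`. [folklore] -/
theorem integral_norm_freeFlow_le [CompleteSpace F'] (hh : Integrable h volume) (hν : 0 < ν)
    (t : ℝ) : ∫ x, ‖freeFlow ν h t x‖ ≤ ∫ x, ‖h x‖ := by
  rcases le_or_gt t 0 with ht | ht
  · rw [freeFlow_of_nonpos ν h ht]
  · rw [freeFlow_of_pos ν h ht]
    have h1 := lintegral_enorm_heatExtension_le hh (mul_pos hν ht)
    rw [integral_norm_eq_lintegral_enorm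
        (integrable_heatExtension hh (mul_pos hν ht)).aestronglyMeasurable,
      integral_norm_eq_lintegral_enorm hh.aestronglyMeasurable]
    exact ENNReal.toReal_mono hh.2.ne h1

/-- **Joint continuity of the free flow** `(t, x) ↦ e^{νtΔ}h(x)` on `ℝ × E` for admissible
`h` (constant in `t ≤ 0`; `tendsto_heatExtension_nhdsWithin_prod` at `t = 0`). [folklore] -/
theorem continuous_uncurry_freeFlow (hh : IsHeatAdmissible h) (hν : 0 < ν) :
    Continuous (uncurry (freeFlow ν h)) := by
  haveI : CompleteSpace F' := FiniteDimensional.complete ℝ F'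
  obtain ⟨C, hC⟩ := hh.exists_bound
  have hhc : Continuous h := hh.contDiff.continuous
  -- the positive-time expression and its continuity on `(0, ∞) × E`
  have hpos : ContinuousOn (fun q : ℝ × E ↦ heatExtension h (ν * q.1) q.2) (Ioi 0 ×ˢ univ) := by
    have h1 := continuousOn_uncurry_heatExtension hhc hC
    have hmap : MapsTo (fun q : ℝ × E ↦ (ν * q.1, q.2)) (Ioi 0 ×ˢ univ) (Ioi 0 ×ˢ univ) :=
      fun q hq ↦ mem_prod.2 ⟨mul_pos hν (mem_prod.1 hq).1, mem_univ _⟩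
    have hf : Continuous fun q : ℝ × E ↦ (ν * q.1, q.2) :=
      (continuous_const.mul continuous_fst).prodMk continuous_snd
    have h2 := h1.comp hf.continuousOn hmap
    exact h2
  refine continuous_iff_continuousAt.2 fun q₀ ↦ ?_
  obtain ⟨t₀, x₀⟩ := q₀
  rcases lt_trichotomy t₀ 0 with ht₀ | rfl | ht₀
  · -- `t₀ < 0`: locally the datum
    have heq : (uncurry (freeFlow ν h)) =ᶠ[𝓝 (t₀, x₀)] fun q ↦ h q.2 := by
      have hO : IsOpen {q : ℝ × E | q.1 < 0} := isOpen_lt continuous_fst continuous_const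
      filter_upwards [hO.mem_nhds ht₀] with q hq
      simp only [uncurry] at hq ⊢
      rw [freeFlow_of_nonpos ν h (le_of_lt hq)]
    exact (ContinuousAt.congr (hhc.comp continuous_snd).continuousAt heq.symm)
  · -- `t₀ = 0`: from the left the datum, from the right the heat extension
    have hunion : ({q : ℝ × E | q.1 ≤ 0} ∪ Ioi 0 ×ˢ univ) = univ := by
      ext q
      simp only [mem_union, mem_setOf_eq, mem_prod, mem_Ioi, mem_univ, and_true, iff_true]
      exact le_or_gt q.1 0
    have h0 : uncurry (freeFlow ν h) (0, x₀) = h x₀ := by simp [uncurry]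
    rw [← continuousWithinAt_univ, ← hunion, continuousWithinAt_union]
    constructor
    · refine (hhc.comp continuous_snd).continuousWithinAt.congr (fun q hq ↦ ?_) h0
      simp only [uncurry, mem_setOf_eq] at hq ⊢
      rw [freeFlow_of_nonpos ν h hq]
      rfl
    · have ht := tendsto_heatExtension_nhdsWithin_prod hhc hC x₀
      have hmap : Tendsto (fun q : ℝ × E ↦ (ν * q.1, q.2)) (𝓝[Ioi 0 ×ˢ univ] ((0 : ℝ), x₀))
          (𝓝[Ioi 0 ×ˢ univ] ((0 : ℝ), x₀)) := by
        have hc : ContinuousWithinAt (fun q : ℝ × E ↦ (ν * q.1, q.2)) (Ioi 0 ×ˢ univ) (0, x₀) :=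
          ((continuous_const.mul continuous_fst).prodMk continuous_snd).continuousWithinAt
        have h := hc.tendsto_nhdsWithin (fun q hq ↦ mem_prod.2 ⟨mul_pos hν (mem_prod.1 hq).1, mem_univ _⟩)
        rw [mul_zero] at h
        exact h
      have h2 := ht.comp hmap
      rw [ContinuousWithinAt, h0]
      refine h2.congr' ?_
      filter_upwards [self_mem_nhdsWithin] with q hq
      simp only [comp_apply, uncurry]
      rw [freeFlow_of_pos ν h (mem_prod.1 hq).1]
  · -- `t₀ > 0`: locally the heat extension
    have heq : (uncurry (freeFlow ν h)) =ᶠ[𝓝 (t₀, x₀)] fun q ↦ heatExtension h (ν * q.1) q.2 := by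
      have hO : IsOpen {q : ℝ × E | 0 < q.1} := isOpen_lt continuous_const continuous_fst
      filter_upwards [hO.mem_nhds ht₀] with q hq
      simp only [uncurry] at hq ⊢
      rw [freeFlow_of_pos ν h hq]
    have hO : IsOpen (Ioi (0 : ℝ) ×ˢ (univ : Set E)) := isOpen_Ioi.prod isOpen_univ
    exact (hpos.continuousAt (hO.mem_nhds (mem_prod.2 ⟨mem_Ioi.2 ht₀, mem_univ _⟩))).congr heq.symm

end FreeFlow

/-! ### The zero-initial-value solution: bounds, integrability, joint continuity -/

section Zero

/-- **Uniform bound below a time** for `v = heatDuhamelZero ν Θ`. [folklore] -/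
theorem exists_norm_heatDuhamelZero_le (hΘ : IsSpaceTimeTestOn (⊤ : Opens (ℝ × E)) Θ)
    (hν : 0 < ν) (T : ℝ) :
    ∃ C : ℝ, ∀ t, t ≤ T → ∀ x, ‖heatDuhamelZero ν Θ t x‖ ≤ C := by
  obtain ⟨C₁, _, hC₁⟩ := exists_norm_heatDuhamelFwd_le hΘ hν T
  obtain ⟨C₂, hC₂⟩ := (isHeatAdmissible_heatDuhamelFwd hν hΘ 0).exists_bound
  refine ⟨C₁ + C₂, fun t ht x ↦ ?_⟩
  rw [heatDuhamelZero_apply]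
  exact (norm_sub_le _ _).trans (add_le_add (hC₁ t ht x) (norm_freeFlow_le hC₂ hν t x))

/-- The slices of `v` are integrable. [folklore] -/
theorem integrable_heatDuhamelZero (hΘ : IsSpaceTimeTestOn (⊤ : Opens (ℝ × E)) Θ) (hν : 0 < ν)
    (t : ℝ) : Integrable (heatDuhamelZero ν Θ t) volume := by
  haveI : CompleteSpace F' := FiniteDimensional.complete ℝ F'
  exact (integrable_heatDuhamelFwd hΘ hν t).sub
    (integrable_freeFlow (integrable_heatDuhamelFwd hΘ hν 0) hν t)

/-- **Uniform `L¹` bound below a time** for `v`. [folklore] -/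
theorem exists_integral_norm_heatDuhamelZero_le (hΘ : IsSpaceTimeTestOn (⊤ : Opens (ℝ × E)) Θ)
    (hν : 0 < ν) (T : ℝ) :
    ∃ C : ℝ, ∀ t, t ≤ T → ∫ x, ‖heatDuhamelZero ν Θ t x‖ ≤ C := by
  haveI : CompleteSpace F' := FiniteDimensional.complete ℝ F'
  obtain ⟨C₁, _, hC₁⟩ := exists_integral_norm_heatDuhamelFwd_le hΘ hν T
  have hi0 := integrable_heatDuhamelFwd hΘ hν 0
  refine ⟨C₁ + ∫ x, ‖heatDuhamelFwd ν Θ 0 x‖, fun t ht ↦ ?_⟩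
  have hi1 := integrable_heatDuhamelFwd hΘ hν t
  have hi2 := integrable_freeFlow hi0 hν t
  calc ∫ x, ‖heatDuhamelZero ν Θ t x‖
      ≤ ∫ x, ‖heatDuhamelFwd ν Θ t x‖ + ‖freeFlow ν (heatDuhamelFwd ν Θ 0) t x‖ := by
        refine integral_mono (integrable_heatDuhamelZero hΘ hν t).norm (hi1.norm.add hi2.norm)
          fun x ↦ ?_
        rw [heatDuhamelZero_apply]
        exact norm_sub_le _ _
    _ = (∫ x, ‖heatDuhamelFwd ν Θ t x‖) + ∫ x, ‖freeFlow ν (heatDuhamelFwd ν Θ 0) t x‖ :=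
        integral_add hi1.norm hi2.norm
    _ ≤ C₁ + ∫ x, ‖heatDuhamelFwd ν Θ 0 x‖ :=
        add_le_add (hC₁ t ht) (integral_norm_freeFlow_le hi0 hν t)

/-- **Joint continuity** of `(t, x) ↦ v(t)(x)` on `ℝ × E`. [folklore] -/
theorem continuous_uncurry_heatDuhamelZero (hΘ : IsSpaceTimeTestOn (⊤ : Opens (ℝ × E)) Θ)
    (hν : 0 < ν) : Continuous (uncurry (heatDuhamelZero ν Θ)) := by
  haveI : CompleteSpace F' := FiniteDimensional.complete ℝ F'
  have h1 : Continuous (uncurry (heatDuhamelFwd ν Θ)) := (contDiff_uncurry_heatDuhamelFwd hΘ hν).continuous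
  have h2 := continuous_uncurry_freeFlow (isHeatAdmissible_heatDuhamelFwd hν hΘ 0) hν
  exact h1.sub h2

/-- Joint continuity in the order `(x, t)`. [folklore] -/
theorem continuous_heatDuhamelZero_swap (hΘ : IsSpaceTimeTestOn (⊤ : Opens (ℝ × E)) Θ)
    (hν : 0 < ν) : Continuous fun q : E × ℝ ↦ heatDuhamelZero ν Θ q.2 q.1 :=
  (continuous_uncurry_heatDuhamelZero hΘ hν).comp (continuous_snd.prodMk continuous_fst)

/-- Continuity in time at a fixed point. [folklore] -/
theorem continuous_heatDuhamelZero_time (hΘ : IsSpaceTimeTestOn (⊤ : Opens (ℝ × E)) Θ)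
    (hν : 0 < ν) (x : E) : Continuous fun s ↦ heatDuhamelZero ν Θ s x :=
  (continuous_uncurry_heatDuhamelZero hΘ hν).comp (continuous_id.prodMk continuous_const)

/-- Continuity in space at a fixed time. [folklore] -/
theorem continuous_heatDuhamelZero_space (hΘ : IsSpaceTimeTestOn (⊤ : Opens (ℝ × E)) Θ)
    (hν : 0 < ν) (s : ℝ) : Continuous (heatDuhamelZero ν Θ s) :=
  (contDiff_heatDuhamelZero hΘ hν s).continuous

end Zero

/-! ### Slab integrability of pairings -/

section Slab

/-- Integrability in `x` of `⟪v[Θ₁](s), v[Θ₂](s)⟫`. [folklore] -/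
theorem integrable_inner_heatDuhamelZero (hΘ₁ : IsSpaceTimeTestOn (⊤ : Opens (ℝ × E)) Θ₁)
    (hΘ₂ : IsSpaceTimeTestOn (⊤ : Opens (ℝ × E)) Θ₂) (hν : 0 < ν) (s : ℝ) :
    Integrable (fun x ↦ ⟪heatDuhamelZero ν Θ₁ s x, heatDuhamelZero ν Θ₂ s x⟫) volume := by
  obtain ⟨C, hC⟩ := exists_norm_heatDuhamelZero_le hΘ₁ hν s
  exact integrable_inner_of_norm_le (continuous_heatDuhamelZero_space hΘ₁ hν s)
    (hC s le_rfl) (integrable_heatDuhamelZero hΘ₂ hν s)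

/-- Integrability in `x` of `⟪v[Θ₁](s), Θ₂(s)⟫`. [folklore] -/
theorem integrable_inner_heatDuhamelZero_test (hΘ₁ : IsSpaceTimeTestOn (⊤ : Opens (ℝ × E)) Θ₁)
    (hΘ₂ : IsSpaceTimeTestOn (⊤ : Opens (ℝ × E)) Θ₂) (hν : 0 < ν) (s : ℝ) :
    Integrable (fun x ↦ ⟪heatDuhamelZero ν Θ₁ s x, Θ₂ s x⟫) volume := by
  obtain ⟨C, hC⟩ := exists_norm_heatDuhamelZero_le hΘ₁ hν s
  exact integrable_inner_of_norm_le (continuous_heatDuhamelZero_space hΘ₁ hν s) (hC s le_rfl)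
    ((hΘ₂.contDiff_slice s).continuous.integrable_of_hasCompactSupport
      (hΘ₂.hasCompactSupport_slice s))

/-- **Joint integrability of `⟪v[Θ₁], v[Θ₂]⟫` on the slab `E × (0, T]`** (the time variable
is frozen above `T`, which does not change the integrand on the slab). [folklore] -/
theorem integrable_prod_inner_heatDuhamelZero (hΘ₁ : IsSpaceTimeTestOn (⊤ : Opens (ℝ × E)) Θ₁)
    (hΘ₂ : IsSpaceTimeTestOn (⊤ : Opens (ℝ × E)) Θ₂) (hν : 0 < ν) (T : ℝ) :
    Integrable (fun q : E × ℝ ↦ ⟪heatDuhamelZero ν Θ₁ q.2 q.1, heatDuhamelZero ν Θ₂ q.2 q.1⟫)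
      ((volume : Measure E).prod (volume.restrict (Ioc 0 T))) := by
  obtain ⟨C₀, hC₀⟩ := exists_norm_heatDuhamelZero_le hΘ₁ hν T
  obtain ⟨C₁, hC₁⟩ := exists_integral_norm_heatDuhamelZero_le hΘ₂ hν T
  set U : ℝ → E → F' := fun s x ↦ heatDuhamelZero ν Θ₁ (min s T) x with hU
  set G : ℝ → E → F' := fun s x ↦ heatDuhamelZero ν Θ₂ (min s T) x with hG
  have hmin : Continuous fun s : ℝ ↦ min s T := continuous_id.min continuous_const
  have hUc : Continuous (uncurry U) :=
    (continuous_uncurry_heatDuhamelZero hΘ₁ hν).comp ((hmin.comp continuous_fst).prodMk continuous_snd)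
  have hGc : Continuous (uncurry G) :=
    (continuous_uncurry_heatDuhamelZero hΘ₂ hν).comp ((hmin.comp continuous_fst).prodMk continuous_snd)
  have hUb : ∀ s x, ‖U s x‖ ≤ C₀ := fun s x ↦ hC₀ _ (min_le_right _ _) x
  have hGi : ∀ s, Integrable (G s) volume := fun s ↦ integrable_heatDuhamelZero hΘ₂ hν _
  have hGb : ∀ s, ∫ x, ‖G s x‖ ≤ C₁ := fun s ↦ hC₁ _ (min_le_right _ _)
  have h := integrable_prod_inner_of_bound hUc hGc hUb hGi hGb 0 T
  refine h.congr ?_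
  have hS : ∀ᵐ q ∂((volume : Measure E).prod (volume.restrict (Ioc 0 T))), q.2 ∈ Ioc 0 T :=
    (Measure.quasiMeasurePreserving_snd (μ := (volume : Measure E))
      (ν := volume.restrict (Ioc 0 T))).ae (ae_restrict_mem measurableSet_Ioc)
  filter_upwards [hS] with q hq
  simp only [hU, hG, min_eq_left hq.2]

/-- **Joint integrability of `⟪v[Θ₁], Θ₂⟫` on the slab `E × (0, T]`.** [folklore] -/
theorem integrable_prod_inner_heatDuhamelZero_test
    (hΘ₁ : IsSpaceTimeTestOn (⊤ : Opens (ℝ × E)) Θ₁)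
    (hΘ₂ : IsSpaceTimeTestOn (⊤ : Opens (ℝ × E)) Θ₂) (hν : 0 < ν) (T : ℝ) :
    Integrable (fun q : E × ℝ ↦ ⟪heatDuhamelZero ν Θ₁ q.2 q.1, Θ₂ q.2 q.1⟫)
      ((volume : Measure E).prod (volume.restrict (Ioc 0 T))) := by
  obtain ⟨C₀, hC₀⟩ := exists_norm_heatDuhamelZero_le hΘ₁ hν T
  obtain ⟨M₁, _, hM₁⟩ := hΘ₂.exists_integral_norm_slice_le
  set U : ℝ → E → F' := fun s x ↦ heatDuhamelZero ν Θ₁ (min s T) x with hU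
  have hmin : Continuous fun s : ℝ ↦ min s T := continuous_id.min continuous_const
  have hUc : Continuous (uncurry U) :=
    (continuous_uncurry_heatDuhamelZero hΘ₁ hν).comp ((hmin.comp continuous_fst).prodMk continuous_snd)
  have hUb : ∀ s x, ‖U s x‖ ≤ C₀ := fun s x ↦ hC₀ _ (min_le_right _ _) x
  have hGi : ∀ s, Integrable (Θ₂ s) volume := fun s ↦
    (hΘ₂.contDiff_slice s).continuous.integrable_of_hasCompactSupport (hΘ₂.hasCompactSupport_slice s)
  have h := integrable_prod_inner_of_bound hUc hΘ₂.continuous_uncurry hUb hGi hM₁ 0 T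
  refine h.congr ?_
  have hS : ∀ᵐ q ∂((volume : Measure E).prod (volume.restrict (Ioc 0 T))), q.2 ∈ Ioc 0 T :=
    (Measure.quasiMeasurePreserving_snd (μ := (volume : Measure E))
      (ν := volume.restrict (Ioc 0 T))).ae (ae_restrict_mem measurableSet_Ioc)
  filter_upwards [hS] with q hq
  simp only [hU, min_eq_left hq.2]

end Slab

/-! ### Integration by parts at a slice -/

section IBP

/-- **Integration by parts between zero-initial-value fields** (no boundary terms):
`∫ ⟪v[Θ₁](s), v[∂ᵥ∂ᵥΘ₂](s)⟫ = -∫ ⟪v[∂ᵥΘ₁](s), v[∂ᵥΘ₂](s)⟫`. [folklore] -/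
theorem integral_inner_heatDuhamelZero_fderiv_fderiv
    (hΘ₁ : IsSpaceTimeTestOn (⊤ : Opens (ℝ × E)) Θ₁)
    (hΘ₂ : IsSpaceTimeTestOn (⊤ : Opens (ℝ × E)) Θ₂) (hν : 0 < ν) (s : ℝ) (v : E) :
    ∫ x, ⟪heatDuhamelZero ν Θ₁ s x,
        heatDuhamelZero ν (fun t y ↦ fderiv ℝ (fun z ↦ fderiv ℝ (Θ₂ t) z v) y v) s x⟫ =
      -∫ x, ⟪heatDuhamelZero ν (fun t y ↦ fderiv ℝ (Θ₁ t) y v) s x,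
        heatDuhamelZero ν (fun t y ↦ fderiv ℝ (Θ₂ t) y v) s x⟫ := by
  have hΘ₁v := hΘ₁.fderiv_apply_top v
  have hΘ₂v := hΘ₂.fderiv_apply_top v
  have hΘ₂vv := hΘ₂v.fderiv_apply_top v
  set f : E → F' := heatDuhamelZero ν Θ₁ s with hf
  set g : E → F' := heatDuhamelZero ν (fun t y ↦ fderiv ℝ (Θ₂ t) y v) s with hg
  have hfd : Differentiable ℝ f := (contDiff_heatDuhamelZero hΘ₁ hν s).differentiable (by simp)
  have hgd : Differentiable ℝ g := (contDiff_heatDuhamelZero hΘ₂v hν s).differentiable (by simp)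
  have hf'v : ∀ x, fderiv ℝ f x v = heatDuhamelZero ν (fun t y ↦ fderiv ℝ (Θ₁ t) y v) s x :=
    fun x ↦ fderiv_heatDuhamelZero_apply hΘ₁ hν s x v
  have hg'v : ∀ x, fderiv ℝ g x v =
      heatDuhamelZero ν (fun t y ↦ fderiv ℝ (fun z ↦ fderiv ℝ (Θ₂ t) z v) y v) s x :=
    fun x ↦ fderiv_heatDuhamelZero_apply hΘ₂v hν s x v
  have key := integral_bilinear_hasFDerivAt_right_eq_neg_left_of_integrable
    (μ := (volume : Measure E)) (B := innerSL ℝ (E := F')) (f := f) (f' := fderiv ℝ f) (g := g)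
    (g' := fderiv ℝ g) (v := v) ?_ ?_ ?_ (fun x _ ↦ (hfd x).hasFDerivAt)
    (fun x _ ↦ (hgd x).hasFDerivAt)
  · simp_rw [hg'v, hf'v] at key
    exact key
  · simp_rw [hf'v]
    exact integrable_inner_heatDuhamelZero hΘ₁v hΘ₂v hν s
  · simp_rw [hg'v]
    exact integrable_inner_heatDuhamelZero hΘ₁ hΘ₂vv hν s
  · exact integrable_inner_heatDuhamelZero hΘ₁ hΘ₂v hν s

/-- **`∫ ⟪v, Δv⟫ = -Σᵢ ∫ ‖∂ᵢv‖²`** for `v = v[Θ](s)` (integration by parts in each frame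
direction). [folklore] -/
theorem integral_inner_laplacian_heatDuhamelZero (hΘ : IsSpaceTimeTestOn (⊤ : Opens (ℝ × E)) Θ)
    (hν : 0 < ν) (s : ℝ) :
    ∫ x, ⟪heatDuhamelZero ν Θ s x, (Δ (heatDuhamelZero ν Θ s)) x⟫ =
      -∑ i, ∫ x, ‖fderiv ℝ (heatDuhamelZero ν Θ s) x (stdOrthonormalBasis ℝ E i)‖ ^ 2 := by
  set b := stdOrthonormalBasis ℝ E
  have hi : ∀ i, IsSpaceTimeTestOn (⊤ : Opens (ℝ × E))
      (fun t y ↦ fderiv ℝ (fun z ↦ fderiv ℝ (Θ t) z (b i)) y (b i)) := fun i ↦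
    (hΘ.fderiv_apply_top (b i)).fderiv_apply_top (b i)
  -- `Δv(s) = Σᵢ v[∂ᵢ∂ᵢΘ](s)`
  have hW : ∀ x, (Δ (heatDuhamelZero ν Θ s)) x =
      ∑ i, heatDuhamelZero ν (fun t y ↦ fderiv ℝ (fun z ↦ fderiv ℝ (Θ t) z (b i)) y (b i)) s x := by
    intro x
    rw [IsHeatAdmissible.laplacian_eq_sum (contDiff_heatDuhamelZero hΘ hν s)]
    refine Finset.sum_congr rfl fun i _ ↦ ?_
    rw [fderiv_heatDuhamelZero_eq hΘ hν s (b i),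
      fderiv_heatDuhamelZero_apply (hΘ.fderiv_apply_top (b i)) hν s x (b i)]
  simp_rw [hW, inner_sum]
  rw [integral_finsetSum _ fun i _ ↦ integrable_inner_heatDuhamelZero hΘ (hi i) hν s,
    ← Finset.sum_neg_distrib]
  refine Finset.sum_congr rfl fun i _ ↦ ?_
  rw [integral_inner_heatDuhamelZero_fderiv_fderiv hΘ hΘ hν s (b i)]
  congr 1
  refine integral_congr_ae (Eventually.of_forall fun x ↦ ?_)
  dsimp only
  rw [← fderiv_heatDuhamelZero_apply hΘ hν s x (b i), real_inner_self_eq_norm_sq]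

end IBP

/-! ### The weighted energy identity -/

section Identity

/-- **Pointwise weighted fundamental theorem of calculus**: for `t ≥ 0` and every `x`,
`e^{-2λt}|v(t,x)|² = ∫₀ᵗ e^{-2λs}(2⟪v, νΔv + Θ⟫ - 2λ|v|²)(s,x) ds` (the heat equation on
`[0, ∞)`, one-sided at `0`, and `v(0) = 0`). [cite: Evans2010, §7.1.2, Thm. 2] -/
theorem weighted_sq_norm_heatDuhamelZero_eq (hΘ : IsSpaceTimeTestOn (⊤ : Opens (ℝ × E)) Θ)
    (hν : 0 < ν) (lam : ℝ) {t : ℝ} (ht : 0 ≤ t) (x : E) :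
    Real.exp (-2 * lam * t) * ‖heatDuhamelZero ν Θ t x‖ ^ 2 =
      ∫ s in (0 : ℝ)..t, Real.exp (-2 * lam * s) *
        (2 * ⟪heatDuhamelZero ν Θ s x, ν • (Δ (heatDuhamelZero ν Θ s)) x + Θ s x⟫ -
          2 * lam * ‖heatDuhamelZero ν Θ s x‖ ^ 2) := by
  set v := heatDuhamelZero ν Θ with hv
  have hΘl : IsSpaceTimeTestOn (⊤ : Opens (ℝ × E)) (fun t ↦ Δ (Θ t)) := hΘ.laplacian_top
  -- the derivative within `[0, ∞)`
  have hd : ∀ s, 0 ≤ s → HasDerivWithinAt (fun r ↦ Real.exp (-2 * lam * r) * ‖v r x‖ ^ 2)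
      (Real.exp (-2 * lam * s) * (2 * ⟪v s x, ν • (Δ (v s)) x + Θ s x⟫ -
        2 * lam * ‖v s x‖ ^ 2)) (Ici 0) s := by
    intro s hs
    have h1 : HasDerivWithinAt (fun r ↦ Real.exp (-2 * lam * r)) (Real.exp (-2 * lam * s) * (-2 * lam))
        (Ici 0) s := ((Real.hasDerivAt_exp _).comp s ((hasDerivAt_id s).const_mul (-2 * lam))).hasDerivWithinAt.congr_deriv (by simp)
    have h2 := (hasDerivWithinAt_heatDuhamelZero hΘ hν hs x).norm_sq
    have h := h1.mul h2
    refine h.congr_deriv ?_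
    simp only [hv]
    ring
  have hcont : ContinuousOn (fun r ↦ Real.exp (-2 * lam * r) * ‖v r x‖ ^ 2) (Icc 0 t) :=
    fun r hr ↦ ((hd r hr.1).continuousWithinAt).mono Icc_subset_Ici_self
  have hderiv : ∀ r ∈ Ioo 0 t, HasDerivAt (fun r ↦ Real.exp (-2 * lam * r) * ‖v r x‖ ^ 2)
      (Real.exp (-2 * lam * r) * (2 * ⟪v r x, ν • (Δ (v r)) x + Θ r x⟫ -
        2 * lam * ‖v r x‖ ^ 2)) r := fun r hr ↦
    (hd r hr.1.le).hasDerivAt (Ici_mem_nhds hr.1)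
  -- continuity of the integrand in `s`
  have hc : Continuous fun s ↦ Real.exp (-2 * lam * s) * (2 * ⟪v s x, ν • (Δ (v s)) x + Θ s x⟫ -
      2 * lam * ‖v s x‖ ^ 2) := by
    have hvs : Continuous fun s ↦ v s x := continuous_heatDuhamelZero_time hΘ hν x
    have hls : Continuous fun s ↦ (Δ (v s)) x := by
      have h := continuous_heatDuhamelZero_time hΘl hν x
      refine h.congr fun s ↦ ?_
      exact (laplacian_heatDuhamelZero hΘ hν s x).symm
    have hΘs : Continuous fun s ↦ Θ s x :=
      hΘ.continuous_uncurry.comp (continuous_id.prodMk continuous_const)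
    have he : Continuous fun s ↦ Real.exp (-2 * lam * s) := by fun_prop
    exact he.mul ((continuous_const.mul (hvs.inner ((hls.const_smul ν).add hΘs))).sub
      (continuous_const.mul (hvs.norm.pow 2)))
  rw [intervalIntegral.integral_eq_sub_of_hasDerivAt_of_le ht hcont hderiv (hc.intervalIntegrable _ _)]
  simp [hv]

/-- **The slice identity**: integrating the pointwise integrand in `x`,
`∫ e^{-2λs}(2⟪v, νΔv + Θ⟫ - 2λ|v|²) = e^{-2λs}(-2ν Σᵢ‖∂ᵢv‖₂² + 2⟨v, Θ⟩ - 2λ‖v‖₂²)`.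
[cite: Evans2010, §7.1.2, Thm. 2] -/
theorem weighted_slice_identity_heatDuhamelZero (hΘ : IsSpaceTimeTestOn (⊤ : Opens (ℝ × E)) Θ)
    (hν : 0 < ν) (lam s : ℝ) :
    ∫ x, Real.exp (-2 * lam * s) *
        (2 * ⟪heatDuhamelZero ν Θ s x, ν • (Δ (heatDuhamelZero ν Θ s)) x + Θ s x⟫ -
          2 * lam * ‖heatDuhamelZero ν Θ s x‖ ^ 2) =
      Real.exp (-2 * lam * s) *
        (-(2 * ν * ∑ i, ∫ x, ‖fderiv ℝ (heatDuhamelZero ν Θ s) x (stdOrthonormalBasis ℝ E i)‖ ^ 2) +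
          2 * (∫ x, ⟪heatDuhamelZero ν Θ s x, Θ s x⟫) -
            2 * lam * ∫ x, ‖heatDuhamelZero ν Θ s x‖ ^ 2) := by
  set v := heatDuhamelZero ν Θ with hv
  have hΘl : IsSpaceTimeTestOn (⊤ : Opens (ℝ × E)) (fun t ↦ Δ (Θ t)) := hΘ.laplacian_top
  -- the three integrable slice functions
  have iL : Integrable (fun x ↦ ⟪v s x, (Δ (v s)) x⟫) volume := by
    have h := integrable_inner_heatDuhamelZero hΘ hΘl hν s
    refine h.congr (Eventually.of_forall fun x ↦ ?_)
    simp only [hv]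
    rw [laplacian_heatDuhamelZero hΘ hν s x]
  have iT : Integrable (fun x ↦ ⟪v s x, Θ s x⟫) volume := integrable_inner_heatDuhamelZero_test hΘ hΘ hν s
  have iN : Integrable (fun x ↦ ‖v s x‖ ^ 2) volume := by
    have h := integrable_inner_heatDuhamelZero hΘ hΘ hν s
    refine h.congr (Eventually.of_forall fun x ↦ ?_)
    simp only [hv]
    exact real_inner_self_eq_norm_sq _
  have hfun : (fun x ↦ Real.exp (-2 * lam * s) *
      (2 * ⟪v s x, ν • (Δ (v s)) x + Θ s x⟫ - 2 * lam * ‖v s x‖ ^ 2)) =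
      fun x ↦ Real.exp (-2 * lam * s) * ((2 * ν) * ⟪v s x, (Δ (v s)) x⟫ + 2 * ⟪v s x, Θ s x⟫ -
        2 * lam * ‖v s x‖ ^ 2) := by
    funext x
    rw [inner_add_right, real_inner_smul_right]
    ring
  have i12 : Integrable (fun x ↦ (2 * ν) * ⟪v s x, (Δ (v s)) x⟫ + 2 * ⟪v s x, Θ s x⟫) volume :=
    (iL.const_mul _).add (iT.const_mul _)
  rw [hfun, integral_const_mul, integral_sub i12 (iN.const_mul _),
    integral_add (iL.const_mul _) (iT.const_mul _), integral_const_mul, integral_const_mul,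
    integral_const_mul, integral_inner_laplacian_heatDuhamelZero hΘ hν s]
  ring

/-- Slab integrability of the weighted quadratic quantities (bounded continuous weight times
an integrable pairing). [folklore] -/
theorem integrable_prod_weight_mul {Φ : E × ℝ → ℝ} {T : ℝ}
    (hΦ : Integrable Φ ((volume : Measure E).prod (volume.restrict (Ioc 0 T)))) (lam : ℝ) :
    Integrable (fun q : E × ℝ ↦ Real.exp (-2 * lam * q.2) * Φ q)
      ((volume : Measure E).prod (volume.restrict (Ioc 0 T))) := by
  refine hΦ.bdd_mul (c := max 1 (Real.exp (-2 * lam * T)) + Real.exp 0 + Real.exp (-2 * lam * 0) +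
      Real.exp (|2 * lam * T|)) ?_ ?_
  · exact ((Real.continuous_exp.comp (continuous_const.mul continuous_snd)).aestronglyMeasurable)
  · have hS : ∀ᵐ q ∂((volume : Measure E).prod (volume.restrict (Ioc 0 T))), q.2 ∈ Ioc 0 T :=
      (Measure.quasiMeasurePreserving_snd (μ := (volume : Measure E))
        (ν := volume.restrict (Ioc 0 T))).ae (ae_restrict_mem measurableSet_Ioc)
    filter_upwards [hS] with q hq
    rw [Real.norm_eq_abs, abs_of_pos (Real.exp_pos _)]
    have h1 : Real.exp (-2 * lam * q.2) ≤ Real.exp (|2 * lam * T|) := by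
      refine Real.exp_le_exp.2 ?_
      have hq2 : 0 ≤ q.2 := hq.1.le
      have hq3 : q.2 ≤ T := hq.2
      rcases le_or_gt 0 lam with hl | hl
      · calc -2 * lam * q.2 ≤ 0 := by nlinarith
          _ ≤ |2 * lam * T| := abs_nonneg _
      · calc -2 * lam * q.2 ≤ -2 * lam * T := by nlinarith
          _ ≤ |2 * lam * T| := by
              rw [show -2 * lam * T = -(2 * lam * T) by ring]
              exact neg_le_abs _
    have h2 : 0 ≤ max 1 (Real.exp (-2 * lam * T)) + Real.exp 0 + Real.exp (-2 * lam * 0) := by positivity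
    linarith

/-- **The weighted energy identity** for `v = heatDuhamelZero ν Θ`, `t ≥ 0`, `λ ∈ ℝ`:
`e^{-2λt}‖v(t)‖₂² + 2λ ∫₀ᵗ e^{-2λs}‖v(s)‖₂² ds + 2ν ∫₀ᵗ e^{-2λs} Σᵢ‖∂ᵢv(s)‖₂² ds
 = 2 ∫₀ᵗ e^{-2λs} ⟨v(s), Θ(s)⟩ ds`.
For `λ = 0` this is the energy identity `‖v(t)‖₂² + 2ν∫₀ᵗΣᵢ‖∂ᵢv‖₂² = 2∫₀ᵗ⟨v, Θ⟩`.
[cite: Evans2010, §7.1.2, Thm. 2] -/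
theorem weighted_energy_identity_heatDuhamelZero (hΘ : IsSpaceTimeTestOn (⊤ : Opens (ℝ × E)) Θ)
    (hν : 0 < ν) (lam : ℝ) {t : ℝ} (ht : 0 ≤ t) :
    Real.exp (-2 * lam * t) * (∫ x, ‖heatDuhamelZero ν Θ t x‖ ^ 2) +
        2 * lam * (∫ s in (0 : ℝ)..t, Real.exp (-2 * lam * s) * ∫ x, ‖heatDuhamelZero ν Θ s x‖ ^ 2) +
        2 * ν * (∫ s in (0 : ℝ)..t, Real.exp (-2 * lam * s) *
          ∑ i, ∫ x, ‖fderiv ℝ (heatDuhamelZero ν Θ s) x (stdOrthonormalBasis ℝ E i)‖ ^ 2) =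
      2 * ∫ s in (0 : ℝ)..t, Real.exp (-2 * lam * s) * ∫ x, ⟪heatDuhamelZero ν Θ s x, Θ s x⟫ := by
  set v := heatDuhamelZero ν Θ with hv
  set bE := stdOrthonormalBasis ℝ E
  have hΘl : IsSpaceTimeTestOn (⊤ : Opens (ℝ × E)) (fun t ↦ Δ (Θ t)) := hΘ.laplacian_top
  have hΘi : ∀ i, IsSpaceTimeTestOn (⊤ : Opens (ℝ × E)) (fun t y ↦ fderiv ℝ (Θ t) y (bE i)) :=
    fun i ↦ hΘ.fderiv_apply_top (bE i)
  -- Step 1: integrate the pointwise identity in `x` and swap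
  have hjoint : Integrable (fun q : E × ℝ ↦ Real.exp (-2 * lam * q.2) *
      (2 * ⟪v q.2 q.1, ν • (Δ (v q.2)) q.1 + Θ q.2 q.1⟫ - 2 * lam * ‖v q.2 q.1‖ ^ 2))
      ((volume : Measure E).prod (volume.restrict (Ioc 0 t))) := by
    have i1 : Integrable (fun q : E × ℝ ↦ ⟪v q.2 q.1, heatDuhamelZero ν (fun t ↦ Δ (Θ t)) q.2 q.1⟫)
        ((volume : Measure E).prod (volume.restrict (Ioc 0 t))) :=
      integrable_prod_inner_heatDuhamelZero hΘ hΘl hν t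
    have i2 : Integrable (fun q : E × ℝ ↦ ⟪v q.2 q.1, Θ q.2 q.1⟫)
        ((volume : Measure E).prod (volume.restrict (Ioc 0 t))) :=
      integrable_prod_inner_heatDuhamelZero_test hΘ hΘ hν t
    have i3 : Integrable (fun q : E × ℝ ↦ ⟪v q.2 q.1, v q.2 q.1⟫)
        ((volume : Measure E).prod (volume.restrict (Ioc 0 t))) :=
      integrable_prod_inner_heatDuhamelZero hΘ hΘ hν t
    have i : Integrable (fun q : E × ℝ ↦ (2 * ν) * ⟪v q.2 q.1, heatDuhamelZero ν (fun t ↦ Δ (Θ t)) q.2 q.1⟫ +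
        2 * ⟪v q.2 q.1, Θ q.2 q.1⟫ - 2 * lam * ⟪v q.2 q.1, v q.2 q.1⟫)
        ((volume : Measure E).prod (volume.restrict (Ioc 0 t))) :=
      ((i1.const_mul _).add (i2.const_mul _)).sub (i3.const_mul _)
    refine (integrable_prod_weight_mul i lam).congr (Eventually.of_forall fun q ↦ ?_)
    simp only [hv]
    rw [inner_add_right, real_inner_smul_right, laplacian_heatDuhamelZero hΘ hν q.2 q.1,
      real_inner_self_eq_norm_sq]
    ring
  have hswap : ∫ x, ∫ s in Ioc 0 t, Real.exp (-2 * lam * s) *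
      (2 * ⟪v s x, ν • (Δ (v s)) x + Θ s x⟫ - 2 * lam * ‖v s x‖ ^ 2) =
      ∫ s in Ioc 0 t, ∫ x, Real.exp (-2 * lam * s) *
        (2 * ⟪v s x, ν • (Δ (v s)) x + Θ s x⟫ - 2 * lam * ‖v s x‖ ^ 2) :=
    integral_integral_swap hjoint
  have step1 : ∫ x, Real.exp (-2 * lam * t) * ‖v t x‖ ^ 2 =
      ∫ s in Ioc 0 t, ∫ x, Real.exp (-2 * lam * s) *
        (2 * ⟪v s x, ν • (Δ (v s)) x + Θ s x⟫ - 2 * lam * ‖v s x‖ ^ 2) := by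
    rw [← hswap]
    refine integral_congr_ae (Eventually.of_forall fun x ↦ ?_)
    dsimp only
    rw [hv, weighted_sq_norm_heatDuhamelZero_eq hΘ hν lam ht x, intervalIntegral.integral_of_le ht]
  -- Step 2: the slice identity, and integrability in time of the three slice functionals
  have iA : IntegrableOn (fun s ↦ Real.exp (-2 * lam * s) * ∫ x, ‖v s x‖ ^ 2) (Ioc 0 t) volume := by
    have h := (integrable_prod_weight_mul (integrable_prod_inner_heatDuhamelZero hΘ hΘ hν t) lam).integral_prod_right
    refine h.congr (Eventually.of_forall fun s ↦ ?_)
    dsimp only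
    rw [← integral_const_mul]
    refine integral_congr_ae (Eventually.of_forall fun x ↦ ?_)
    simp only [hv]
    rw [real_inner_self_eq_norm_sq]
  have iD : ∀ i, IntegrableOn (fun s ↦ Real.exp (-2 * lam * s) *
      ∫ x, ‖fderiv ℝ (v s) x (bE i)‖ ^ 2) (Ioc 0 t) volume := fun i ↦ by
    have h := (integrable_prod_weight_mul
      (integrable_prod_inner_heatDuhamelZero (hΘi i) (hΘi i) hν t) lam).integral_prod_right
    refine h.congr (Eventually.of_forall fun s ↦ ?_)
    dsimp only
    rw [← integral_const_mul]
    refine integral_congr_ae (Eventually.of_forall fun x ↦ ?_)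
    simp only [hv]
    rw [← fderiv_heatDuhamelZero_apply hΘ hν s x (bE i), real_inner_self_eq_norm_sq]
  have iD' : IntegrableOn (fun s ↦ Real.exp (-2 * lam * s) *
      ∑ i, ∫ x, ‖fderiv ℝ (v s) x (bE i)‖ ^ 2) (Ioc 0 t) volume := by
    have h := integrable_finsetSum Finset.univ fun i _ ↦ iD i
    refine h.congr (Eventually.of_forall fun s ↦ ?_)
    simp [Finset.mul_sum]
  have iP : IntegrableOn (fun s ↦ Real.exp (-2 * lam * s) * ∫ x, ⟪v s x, Θ s x⟫) (Ioc 0 t) volume := by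
    have h := (integrable_prod_weight_mul (integrable_prod_inner_heatDuhamelZero_test hΘ hΘ hν t) lam).integral_prod_right
    refine h.congr (Eventually.of_forall fun s ↦ ?_)
    dsimp only
    rw [← integral_const_mul]
  have step2 : ∫ s in Ioc 0 t, ∫ x, Real.exp (-2 * lam * s) *
      (2 * ⟪v s x, ν • (Δ (v s)) x + Θ s x⟫ - 2 * lam * ‖v s x‖ ^ 2) =
      -(2 * ν * ∫ s in Ioc 0 t, Real.exp (-2 * lam * s) * ∑ i, ∫ x, ‖fderiv ℝ (v s) x (bE i)‖ ^ 2) +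
        2 * (∫ s in Ioc 0 t, Real.exp (-2 * lam * s) * ∫ x, ⟪v s x, Θ s x⟫) -
          2 * lam * ∫ s in Ioc 0 t, Real.exp (-2 * lam * s) * ∫ x, ‖v s x‖ ^ 2 := by
    simp_rw [hv, weighted_slice_identity_heatDuhamelZero hΘ hν lam]
    have hsplit : ∀ s, Real.exp (-2 * lam * s) *
        (-(2 * ν * ∑ i, ∫ x, ‖fderiv ℝ (heatDuhamelZero ν Θ s) x (stdOrthonormalBasis ℝ E i)‖ ^ 2) +
          2 * (∫ x, ⟪heatDuhamelZero ν Θ s x, Θ s x⟫) -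
            2 * lam * ∫ x, ‖heatDuhamelZero ν Θ s x‖ ^ 2) =
        -(2 * ν) * (Real.exp (-2 * lam * s) * ∑ i, ∫ x, ‖fderiv ℝ (heatDuhamelZero ν Θ s) x
            (stdOrthonormalBasis ℝ E i)‖ ^ 2) +
          2 * (Real.exp (-2 * lam * s) * ∫ x, ⟪heatDuhamelZero ν Θ s x, Θ s x⟫) -
          2 * lam * (Real.exp (-2 * lam * s) * ∫ x, ‖heatDuhamelZero ν Θ s x‖ ^ 2) := fun s ↦ by
      ring
    simp_rw [hsplit]
    have i12 : IntegrableOn (fun s ↦ -(2 * ν) * (Real.exp (-2 * lam * s) *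
        ∑ i, ∫ x, ‖fderiv ℝ (heatDuhamelZero ν Θ s) x (stdOrthonormalBasis ℝ E i)‖ ^ 2) +
        2 * (Real.exp (-2 * lam * s) * ∫ x, ⟪heatDuhamelZero ν Θ s x, Θ s x⟫)) (Ioc 0 t) volume :=
      (iD'.const_mul _).add (iP.const_mul _)
    rw [integral_sub i12 (iA.const_mul _),
      integral_add (iD'.const_mul _) (iP.const_mul _), integral_const_mul, integral_const_mul,
      integral_const_mul]
    ring
  -- assemble
  rw [intervalIntegral.integral_of_le ht, intervalIntegral.integral_of_le ht,
    intervalIntegral.integral_of_le ht, ← integral_const_mul]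
  linarith [step1, step2]

end Identity

/-! ### The weighted energy inequality -/

section Inequality

/-- The pairing with the data is controlled by the energies (Cauchy–Schwarz and Young):
`2⟨v(s), Θ(s)⟩ ≤ λ‖v(s)‖₂² + λ⁻¹‖Θ(s)‖₂²` for `λ > 0`. [cite: Evans2010, §7.1.2, Thm. 2] -/
theorem two_mul_integral_inner_le (hΘ : IsSpaceTimeTestOn (⊤ : Opens (ℝ × E)) Θ) (hν : 0 < ν)
    {lam : ℝ} (hlam : 0 < lam) (s : ℝ) :
    2 * ∫ x, ⟪heatDuhamelZero ν Θ s x, Θ s x⟫ ≤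
      lam * (∫ x, ‖heatDuhamelZero ν Θ s x‖ ^ 2) + (∫ x, ‖Θ s x‖ ^ 2) / lam := by
  have hv2 : MemLp (heatDuhamelZero ν Θ s) 2 volume := by
    haveI : CompleteSpace F' := FiniteDimensional.complete ℝ F'
    exact ((isHeatAdmissible_heatDuhamelFwd hν hΘ s).memLp_two).sub
      (((isHeatAdmissible_heatDuhamelFwd hν hΘ 0).freeFlow hν s).memLp_two)
  have hΘ2 : MemLp (Θ s) 2 volume :=
    (hΘ.contDiff_slice s).continuous.memLp_of_hasCompactSupport (hΘ.hasCompactSupport_slice s)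
  have hCS := integral_abs_inner_le_sqrt_mul_sqrt hv2 hΘ2
  set A := ∫ x, ‖heatDuhamelZero ν Θ s x‖ ^ 2 with hA
  set B := ∫ x, ‖Θ s x‖ ^ 2 with hB
  have hA0 : 0 ≤ A := integral_nonneg fun _ ↦ sq_nonneg _
  have hB0 : 0 ≤ B := integral_nonneg fun _ ↦ sq_nonneg _
  have h1 : ∫ x, ⟪heatDuhamelZero ν Θ s x, Θ s x⟫ ≤ A ^ (1 / 2 : ℝ) * B ^ (1 / 2 : ℝ) :=
    (le_abs_self _).trans ((abs_integral_le_integral_abs).trans hCS)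
  have hYoung : ∀ {l : ℝ}, 0 < l → ∀ a b : ℝ, 2 * a * b ≤ l * a ^ 2 + b ^ 2 / l := by
    intro l hl a b
    have h := sq_nonneg (l * a - b)
    have h2 : l * (2 * a * b) ≤ l * (l * a ^ 2 + b ^ 2 / l) := by
      rw [mul_add, mul_div_cancel₀ _ hl.ne']
      nlinarith [h]
    exact le_of_mul_le_mul_left h2 hl
  have hY := hYoung hlam (A ^ (1 / 2 : ℝ)) (B ^ (1 / 2 : ℝ))
  have hAsq : (A ^ (1 / 2 : ℝ)) ^ 2 = A := by
    rw [← Real.rpow_natCast, ← Real.rpow_mul hA0]; norm_num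
  have hBsq : (B ^ (1 / 2 : ℝ)) ^ 2 = B := by
    rw [← Real.rpow_natCast, ← Real.rpow_mul hB0]; norm_num
  rw [hAsq, hBsq] at hY
  linarith

omit [FiniteDimensional ℝ F'] in
/-- Integrability in time of the data energy `s ↦ e^{-2λs}‖Θ(s)‖₂²` on `(0, t]`. [folklore] -/
theorem integrableOn_weight_mul_sq_norm_test (hΘ : IsSpaceTimeTestOn (⊤ : Opens (ℝ × E)) Θ)
    (lam t : ℝ) :
    IntegrableOn (fun s ↦ Real.exp (-2 * lam * s) * ∫ x, ‖Θ s x‖ ^ 2) (Ioc 0 t) volume := by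
  have h := (integrable_prod_weight_mul (hΘ.integrable_prod_sq_norm 0 t) lam).integral_prod_right
  refine h.congr (Eventually.of_forall fun s ↦ ?_)
  dsimp only
  rw [← integral_const_mul]

/-- **The weighted energy inequality**, `λ > 0`, `t ≥ 0`:
`e^{-2λt}‖v(t)‖₂² + λ ∫₀ᵗ e^{-2λs}‖v(s)‖₂² + 2ν ∫₀ᵗ e^{-2λs}Σᵢ‖∂ᵢv(s)‖₂² ≤ λ⁻¹ ∫₀ᵗ e^{-2λs}‖Θ(s)‖₂²`.
The lower-order quantities gain the factors `λ⁻¹`, `λ^{-1/2}`. [cite: Evans2010, §7.1.2, Thm. 2] -/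
theorem weighted_energy_le_heatDuhamelZero (hΘ : IsSpaceTimeTestOn (⊤ : Opens (ℝ × E)) Θ)
    (hν : 0 < ν) {lam : ℝ} (hlam : 0 < lam) {t : ℝ} (ht : 0 ≤ t) :
    Real.exp (-2 * lam * t) * (∫ x, ‖heatDuhamelZero ν Θ t x‖ ^ 2) +
        lam * (∫ s in (0 : ℝ)..t, Real.exp (-2 * lam * s) * ∫ x, ‖heatDuhamelZero ν Θ s x‖ ^ 2) +
        2 * ν * (∫ s in (0 : ℝ)..t, Real.exp (-2 * lam * s) *
          ∑ i, ∫ x, ‖fderiv ℝ (heatDuhamelZero ν Θ s) x (stdOrthonormalBasis ℝ E i)‖ ^ 2) ≤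
      lam⁻¹ * ∫ s in (0 : ℝ)..t, Real.exp (-2 * lam * s) * ∫ x, ‖Θ s x‖ ^ 2 := by
  have hid := weighted_energy_identity_heatDuhamelZero hΘ hν lam ht
  -- `2∫ e P ≤ λ ∫ e A + λ⁻¹ ∫ e ‖Θ‖²`
  have iA : IntegrableOn (fun s ↦ Real.exp (-2 * lam * s) * ∫ x, ‖heatDuhamelZero ν Θ s x‖ ^ 2)
      (Ioc 0 t) volume := by
    have h := (integrable_prod_weight_mul (integrable_prod_inner_heatDuhamelZero hΘ hΘ hν t) lam).integral_prod_right
    refine h.congr (Eventually.of_forall fun s ↦ ?_)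
    dsimp only
    rw [← integral_const_mul]
    refine integral_congr_ae (Eventually.of_forall fun x ↦ ?_)
    dsimp only
    rw [real_inner_self_eq_norm_sq]
  have iP : IntegrableOn (fun s ↦ Real.exp (-2 * lam * s) * ∫ x, ⟪heatDuhamelZero ν Θ s x, Θ s x⟫)
      (Ioc 0 t) volume := by
    have h := (integrable_prod_weight_mul (integrable_prod_inner_heatDuhamelZero_test hΘ hΘ hν t) lam).integral_prod_right
    refine h.congr (Eventually.of_forall fun s ↦ ?_)
    dsimp only
    rw [← integral_const_mul]
  have iQ := integrableOn_weight_mul_sq_norm_test hΘ lam t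
  have hP : 2 * (∫ s in (0 : ℝ)..t, Real.exp (-2 * lam * s) * ∫ x, ⟪heatDuhamelZero ν Θ s x, Θ s x⟫) ≤
      lam * (∫ s in (0 : ℝ)..t, Real.exp (-2 * lam * s) * ∫ x, ‖heatDuhamelZero ν Θ s x‖ ^ 2) +
        lam⁻¹ * ∫ s in (0 : ℝ)..t, Real.exp (-2 * lam * s) * ∫ x, ‖Θ s x‖ ^ 2 := by
    rw [intervalIntegral.integral_of_le ht, intervalIntegral.integral_of_le ht,
      intervalIntegral.integral_of_le ht, ← integral_const_mul, ← integral_const_mul,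
      ← integral_const_mul, ← integral_add (iA.const_mul _) (iQ.const_mul _)]
    refine setIntegral_mono_on (iP.const_mul _) ((iA.const_mul _).add (iQ.const_mul _))
      measurableSet_Ioc fun s _ ↦ ?_
    have he : 0 < Real.exp (-2 * lam * s) := Real.exp_pos _
    have h := two_mul_integral_inner_le hΘ hν hlam s
    have h' := mul_le_mul_of_nonneg_left h he.le
    calc 2 * (Real.exp (-2 * lam * s) * ∫ x, ⟪heatDuhamelZero ν Θ s x, Θ s x⟫)
        = Real.exp (-2 * lam * s) * (2 * ∫ x, ⟪heatDuhamelZero ν Θ s x, Θ s x⟫) := by ring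
      _ ≤ Real.exp (-2 * lam * s) * (lam * (∫ x, ‖heatDuhamelZero ν Θ s x‖ ^ 2) +
          (∫ x, ‖Θ s x‖ ^ 2) / lam) := h'
      _ = lam * (Real.exp (-2 * lam * s) * ∫ x, ‖heatDuhamelZero ν Θ s x‖ ^ 2) +
          lam⁻¹ * (Real.exp (-2 * lam * s) * ∫ x, ‖Θ s x‖ ^ 2) := by ring
  linarith

end Inequality

/-! ### The weighted maximal-regularity inequality -/

section Gradient

omit [FiniteDimensional ℝ F'] in
/-- Closure of admissible data under differences. [folklore] -/
theorem IsHeatAdmissible.sub {k₁ k₂ : E → F'} (h₁ : IsHeatAdmissible k₁) (h₂ : IsHeatAdmissible k₂) :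
    IsHeatAdmissible fun x ↦ k₁ x - k₂ x := by
  have h := h₁.add (h₂.const_smul (-1))
  have heq : (k₁ + fun x ↦ (-1 : ℝ) • k₂ x) = fun x ↦ k₁ x - k₂ x := by
    funext x
    simp [sub_eq_add_neg]
  rw [heq] at h
  exact h

/-- The slices of `v = heatDuhamelZero ν Θ` are admissible. [folklore] -/
theorem isHeatAdmissible_heatDuhamelZero (hΘ : IsSpaceTimeTestOn (⊤ : Opens (ℝ × E)) Θ) (hν : 0 < ν)
    (s : ℝ) : IsHeatAdmissible (heatDuhamelZero ν Θ s) :=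
  (isHeatAdmissible_heatDuhamelFwd hν hΘ s).sub ((isHeatAdmissible_heatDuhamelFwd hν hΘ 0).freeFlow hν s)

/-- `‖Δv‖₂² ≤ n Σᵢⱼ ‖∂ⱼ∂ᵢv‖₂²` for `v = heatDuhamelZero ν Θ (s)` (`norm_laplacian_sq_le`
integrated). [folklore] -/
theorem integral_sq_norm_laplacian_heatDuhamelZero_le (hΘ : IsSpaceTimeTestOn (⊤ : Opens (ℝ × E)) Θ)
    (hν : 0 < ν) (s : ℝ) :
    ∫ x, ‖(Δ (heatDuhamelZero ν Θ s)) x‖ ^ 2 ≤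
      (Module.finrank ℝ E : ℝ) * ∑ i, ∑ j, ∫ x,
        ‖fderiv ℝ (fun y ↦ fderiv ℝ (heatDuhamelZero ν Θ s) y (stdOrthonormalBasis ℝ E i)) x
          (stdOrthonormalBasis ℝ E j)‖ ^ 2 := by
  set bE := stdOrthonormalBasis ℝ E
  set v := heatDuhamelZero ν Θ s with hv
  have hva := isHeatAdmissible_heatDuhamelZero hΘ hν s
  have hv2 : ContDiff ℝ 2 v := (contDiff_heatDuhamelZero hΘ hν s).of_le (by norm_cast)
  -- integrability of the pure second derivatives squared
  have hij : ∀ i j, Integrable (fun x ↦ ‖fderiv ℝ (fun y ↦ fderiv ℝ v y (bE i)) x (bE j)‖ ^ 2) volume := by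
    intro i j
    have h := ((hva.fderiv_apply (bE i)).fderiv_apply (bE j)).memLp_two
    exact (memLp_two_iff_integrable_sq_norm h.1).1 h
  have hL : Integrable (fun x ↦ ‖(Δ v) x‖ ^ 2) volume := by
    have h := hva.laplacian.memLp_two
    exact (memLp_two_iff_integrable_sq_norm h.1).1 h
  calc ∫ x, ‖(Δ v) x‖ ^ 2
      ≤ ∫ x, (Module.finrank ℝ E : ℝ) * ∑ i, ∑ j, ‖fderiv ℝ (fun y ↦ fderiv ℝ v y (bE i)) x (bE j)‖ ^ 2 := by
        refine integral_mono hL ((integrable_finsetSum _ fun i _ ↦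
          integrable_finsetSum _ fun j _ ↦ hij i j).const_mul _) fun x ↦ ?_
        exact norm_laplacian_sq_le hv2 x
    _ = (Module.finrank ℝ E : ℝ) * ∑ i, ∑ j, ∫ x, ‖fderiv ℝ (fun y ↦ fderiv ℝ v y (bE i)) x (bE j)‖ ^ 2 := by
        rw [integral_const_mul, integral_finsetSum _ fun i _ ↦ integrable_finsetSum _ fun j _ ↦ hij i j]
        congr 1
        refine Finset.sum_congr rfl fun i _ ↦ ?_
        rw [integral_finsetSum _ fun j _ ↦ hij i j]

/-- The pairing of `Δv` with the data is controlled: `-2⟨Δv(s), Θ(s)⟩ ≤ ν Σᵢⱼ‖∂ⱼ∂ᵢv(s)‖₂² + (n/ν)‖Θ(s)‖₂²`.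
[cite: Evans2010, §7.1.2, Thm. 2] -/
theorem neg_two_mul_integral_inner_laplacian_le (hΘ : IsSpaceTimeTestOn (⊤ : Opens (ℝ × E)) Θ)
    (hν : 0 < ν) (s : ℝ) :
    -(2 * ∫ x, ⟪(Δ (heatDuhamelZero ν Θ s)) x, Θ s x⟫) ≤
      ν * (∑ i, ∑ j, ∫ x, ‖fderiv ℝ (fun y ↦ fderiv ℝ (heatDuhamelZero ν Θ s) y
          (stdOrthonormalBasis ℝ E i)) x (stdOrthonormalBasis ℝ E j)‖ ^ 2) +
        (Module.finrank ℝ E : ℝ) / ν * ∫ x, ‖Θ s x‖ ^ 2 := by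
  set n : ℝ := (Module.finrank ℝ E : ℝ) with hn
  set H := ∑ i, ∑ j, ∫ x, ‖fderiv ℝ (fun y ↦ fderiv ℝ (heatDuhamelZero ν Θ s) y
      (stdOrthonormalBasis ℝ E i)) x (stdOrthonormalBasis ℝ E j)‖ ^ 2 with hH
  have hva := isHeatAdmissible_heatDuhamelZero hΘ hν s
  have hL2 : MemLp (Δ (heatDuhamelZero ν Θ s)) 2 volume := hva.laplacian.memLp_two
  have hΘ2 : MemLp (Θ s) 2 volume :=
    (hΘ.contDiff_slice s).continuous.memLp_of_hasCompactSupport (hΘ.hasCompactSupport_slice s)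
  have hCS := integral_abs_inner_le_sqrt_mul_sqrt hL2 hΘ2
  set A := ∫ x, ‖(Δ (heatDuhamelZero ν Θ s)) x‖ ^ 2 with hA
  set B := ∫ x, ‖Θ s x‖ ^ 2 with hB
  have hA0 : 0 ≤ A := integral_nonneg fun _ ↦ sq_nonneg _
  have hB0 : 0 ≤ B := integral_nonneg fun _ ↦ sq_nonneg _
  have hH0 : 0 ≤ H := Finset.sum_nonneg fun i _ ↦ Finset.sum_nonneg fun j _ ↦
    integral_nonneg fun _ ↦ sq_nonneg _
  have hAH : A ≤ n * H := integral_sq_norm_laplacian_heatDuhamelZero_le hΘ hν s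
  have h1 : -(2 * ∫ x, ⟪(Δ (heatDuhamelZero ν Θ s)) x, Θ s x⟫) ≤ 2 * (A ^ (1 / 2 : ℝ) * B ^ (1 / 2 : ℝ)) := by
    have h := (neg_le_abs _).trans ((abs_integral_le_integral_abs).trans hCS)
    linarith
  have hAsq : (A ^ (1 / 2 : ℝ)) ^ 2 = A := by
    rw [← Real.rpow_natCast, ← Real.rpow_mul hA0]; norm_num
  have hBsq : (B ^ (1 / 2 : ℝ)) ^ 2 = B := by
    rw [← Real.rpow_natCast, ← Real.rpow_mul hB0]; norm_num
  rcases Nat.eq_zero_or_pos (Module.finrank ℝ E) with h0 | hpos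
  · -- dimension zero: `A ≤ 0`, so `A = 0`
    have hn0 : n = 0 := by rw [hn, h0]; simp
    have hA' : A = 0 := le_antisymm (by rw [hn0, zero_mul] at hAH; exact hAH) hA0
    have : A ^ (1 / 2 : ℝ) = 0 := by rw [hA']; exact Real.zero_rpow (by norm_num)
    rw [this, zero_mul, mul_zero] at h1
    have : 0 ≤ ν * H + n / ν * B := by positivity
    linarith
  · have hnpos : 0 < n := by rw [hn]; exact_mod_cast hpos
    -- Young with `l = ν / n` on `a = A^{1/2}`, `b = B^{1/2}`
    have hYoung : ∀ {l : ℝ}, 0 < l → ∀ a b : ℝ, 2 * a * b ≤ l * a ^ 2 + b ^ 2 / l := by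
      intro l hl a b
      have h := sq_nonneg (l * a - b)
      have h2 : l * (2 * a * b) ≤ l * (l * a ^ 2 + b ^ 2 / l) := by
        rw [mul_add, mul_div_cancel₀ _ hl.ne']
        nlinarith [h]
      exact le_of_mul_le_mul_left h2 hl
    have hY := hYoung (div_pos hν hnpos) (A ^ (1 / 2 : ℝ)) (B ^ (1 / 2 : ℝ))
    rw [hAsq, hBsq] at hY
    have h2 : ν / n * A ≤ ν * H := by
      calc ν / n * A ≤ ν / n * (n * H) := mul_le_mul_of_nonneg_left hAH (div_pos hν hnpos).le
        _ = ν * H := by field_simp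
    have h3 : B / (ν / n) = n / ν * B := by field_simp
    rw [h3] at hY
    linarith

/-- `Σᵢ ⟨∂ᵢv(s), ∂ᵢΘ(s)⟩ = -⟨Δv(s), Θ(s)⟩` (boundary-free Green's formula, `Θ(s)` compactly
supported). [folklore] -/
theorem sum_integral_inner_fderiv_eq_neg (hΘ : IsSpaceTimeTestOn (⊤ : Opens (ℝ × E)) Θ)
    (hν : 0 < ν) (s : ℝ) :
    ∑ i, ∫ x, ⟪fderiv ℝ (heatDuhamelZero ν Θ s) x (stdOrthonormalBasis ℝ E i),
        fderiv ℝ (Θ s) x (stdOrthonormalBasis ℝ E i)⟫ =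
      -∫ x, ⟪(Δ (heatDuhamelZero ν Θ s)) x, Θ s x⟫ := by
  have h := integral_inner_laplacian_add_eq_zero (stdOrthonormalBasis ℝ E)
    ((contDiff_heatDuhamelZero hΘ hν s).of_le (by norm_cast))
    (contDiff_infty.1 (hΘ.contDiff_slice s) 1) (Or.inr (hΘ.hasCompactSupport_slice s))
  linarith

/-- **The weighted maximal-regularity inequality** for `v = heatDuhamelZero ν Θ`, `t ≥ 0`,
`λ ∈ ℝ`, `n = dim E`:
`e^{-2λt}Σᵢ‖∂ᵢv(t)‖₂² + 2λ ∫₀ᵗ e^{-2λs}Σᵢ‖∂ᵢv‖₂² + ν ∫₀ᵗ e^{-2λs}Σᵢⱼ‖∂ⱼ∂ᵢv‖₂² ≤ (n/ν) ∫₀ᵗ e^{-2λs}‖Θ‖₂²`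
(the weighted identity for the data `∂ᵢΘ`, summed over `i`, `Σᵢ⟨∂ᵢv, ∂ᵢΘ⟩ = -⟨Δv, Θ⟩`, and
the absorption `-2⟨Δv, Θ⟩ ≤ νΣᵢⱼ‖∂ⱼ∂ᵢv‖₂² + (n/ν)‖Θ‖₂²`). The top-order constant `n/ν` is
independent of `λ` and `t`. [cite: Evans2010, §7.1.2, Thm. 2] -/
theorem weighted_gradient_energy_le_heatDuhamelZero (hΘ : IsSpaceTimeTestOn (⊤ : Opens (ℝ × E)) Θ)
    (hν : 0 < ν) (lam : ℝ) {t : ℝ} (ht : 0 ≤ t) :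
    Real.exp (-2 * lam * t) * (∑ i, ∫ x, ‖fderiv ℝ (heatDuhamelZero ν Θ t) x (stdOrthonormalBasis ℝ E i)‖ ^ 2) +
        2 * lam * (∫ s in (0 : ℝ)..t, Real.exp (-2 * lam * s) *
          ∑ i, ∫ x, ‖fderiv ℝ (heatDuhamelZero ν Θ s) x (stdOrthonormalBasis ℝ E i)‖ ^ 2) +
        ν * (∫ s in (0 : ℝ)..t, Real.exp (-2 * lam * s) * ∑ i, ∑ j, ∫ x,
          ‖fderiv ℝ (fun y ↦ fderiv ℝ (heatDuhamelZero ν Θ s) y (stdOrthonormalBasis ℝ E i)) x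
            (stdOrthonormalBasis ℝ E j)‖ ^ 2) ≤
      (Module.finrank ℝ E : ℝ) / ν * ∫ s in (0 : ℝ)..t, Real.exp (-2 * lam * s) * ∫ x, ‖Θ s x‖ ^ 2 := by
  set bE := stdOrthonormalBasis ℝ E
  set v := heatDuhamelZero ν Θ with hv
  have hΘi : ∀ i, IsSpaceTimeTestOn (⊤ : Opens (ℝ × E)) (fun t y ↦ fderiv ℝ (Θ t) y (bE i)) :=
    fun i ↦ hΘ.fderiv_apply_top (bE i)
  have hΘij : ∀ i j, IsSpaceTimeTestOn (⊤ : Opens (ℝ × E))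
      (fun t y ↦ fderiv ℝ (fun z ↦ fderiv ℝ (Θ t) z (bE i)) y (bE j)) := fun i j ↦ (hΘi i).fderiv_apply_top (bE j)
  -- `v[∂ᵢΘ] = ∂ᵢv` and `∂ⱼ v[∂ᵢΘ] = ∂ⱼ∂ᵢv`
  have hvi : ∀ i s, heatDuhamelZero ν (fun t y ↦ fderiv ℝ (Θ t) y (bE i)) s = fun x ↦ fderiv ℝ (v s) x (bE i) :=
    fun i s ↦ (fderiv_heatDuhamelZero_eq hΘ hν s (bE i)).symm
  -- the identity for each `∂ᵢΘ`
  have hid : ∀ i, Real.exp (-2 * lam * t) * (∫ x, ‖fderiv ℝ (v t) x (bE i)‖ ^ 2) +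
      2 * lam * (∫ s in (0 : ℝ)..t, Real.exp (-2 * lam * s) * ∫ x, ‖fderiv ℝ (v s) x (bE i)‖ ^ 2) +
      2 * ν * (∫ s in (0 : ℝ)..t, Real.exp (-2 * lam * s) *
        ∑ j, ∫ x, ‖fderiv ℝ (fun y ↦ fderiv ℝ (v s) y (bE i)) x (bE j)‖ ^ 2) =
      2 * ∫ s in (0 : ℝ)..t, Real.exp (-2 * lam * s) * ∫ x, ⟪fderiv ℝ (v s) x (bE i), fderiv ℝ (Θ s) x (bE i)⟫ := by
    intro i
    have h := weighted_energy_identity_heatDuhamelZero (hΘi i) hν lam ht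
    simp only [hvi i] at h
    exact h
  -- integrability in time of the slice functionals (for exchanging `Σᵢ` and `∫ ds`)
  have iG : ∀ i, IntervalIntegrable (fun s ↦ Real.exp (-2 * lam * s) * ∫ x, ‖fderiv ℝ (v s) x (bE i)‖ ^ 2) volume 0 t := by
    intro i
    rw [intervalIntegrable_iff_integrableOn_Ioc_of_le ht]
    have h := (integrable_prod_weight_mul (integrable_prod_inner_heatDuhamelZero (hΘi i) (hΘi i) hν t) lam).integral_prod_right
    refine h.congr (Eventually.of_forall fun s ↦ ?_)
    dsimp only
    rw [← integral_const_mul]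
    refine integral_congr_ae (Eventually.of_forall fun x ↦ ?_)
    dsimp only
    rw [hvi i s, real_inner_self_eq_norm_sq]
  have iH : ∀ i, IntervalIntegrable (fun s ↦ Real.exp (-2 * lam * s) *
      ∑ j, ∫ x, ‖fderiv ℝ (fun y ↦ fderiv ℝ (v s) y (bE i)) x (bE j)‖ ^ 2) volume 0 t := by
    intro i
    rw [intervalIntegrable_iff_integrableOn_Ioc_of_le ht]
    have h : ∀ j, IntegrableOn (fun s ↦ Real.exp (-2 * lam * s) *
        ∫ x, ‖fderiv ℝ (fun y ↦ fderiv ℝ (v s) y (bE i)) x (bE j)‖ ^ 2) (Ioc 0 t) volume := by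
      intro j
      have h := (integrable_prod_weight_mul (integrable_prod_inner_heatDuhamelZero (hΘij i j) (hΘij i j) hν t) lam).integral_prod_right
      refine h.congr (Eventually.of_forall fun s ↦ ?_)
      dsimp only
      rw [← integral_const_mul]
      refine integral_congr_ae (Eventually.of_forall fun x ↦ ?_)
      dsimp only
      rw [← fderiv_heatDuhamelZero_apply (hΘi i) hν s x (bE j), hvi i s, real_inner_self_eq_norm_sq]
    have h' := integrable_finsetSum Finset.univ fun j _ ↦ h j
    refine h'.congr (Eventually.of_forall fun s ↦ ?_)
    simp [Finset.mul_sum]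
  have iP : ∀ i, IntervalIntegrable (fun s ↦ Real.exp (-2 * lam * s) *
      ∫ x, ⟪fderiv ℝ (v s) x (bE i), fderiv ℝ (Θ s) x (bE i)⟫) volume 0 t := by
    intro i
    rw [intervalIntegrable_iff_integrableOn_Ioc_of_le ht]
    have h := (integrable_prod_weight_mul (integrable_prod_inner_heatDuhamelZero_test (hΘi i) (hΘi i) hν t) lam).integral_prod_right
    refine h.congr (Eventually.of_forall fun s ↦ ?_)
    dsimp only
    rw [← integral_const_mul]
    refine integral_congr_ae (Eventually.of_forall fun x ↦ ?_)
    dsimp only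
    rw [hvi i s]
  -- sum the identities over `i`
  have hsum := Finset.sum_congr rfl fun i (_ : i ∈ Finset.univ) ↦ hid i
  rw [Finset.sum_add_distrib, Finset.sum_add_distrib, ← Finset.mul_sum, ← Finset.mul_sum,
    ← Finset.mul_sum, ← Finset.mul_sum, ← intervalIntegral.integral_finsetSum fun i _ ↦ iG i,
    ← intervalIntegral.integral_finsetSum fun i _ ↦ iH i,
    ← intervalIntegral.integral_finsetSum fun i _ ↦ iP i] at hsum
  simp only [← Finset.mul_sum] at hsum
  -- `Σᵢ⟨∂ᵢv, ∂ᵢΘ⟩ = -⟨Δv, Θ⟩` inside the time integral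
  have hP : ∫ s in (0 : ℝ)..t, Real.exp (-2 * lam * s) * ∑ i, ∫ x, ⟪fderiv ℝ (v s) x (bE i), fderiv ℝ (Θ s) x (bE i)⟫ =
      ∫ s in (0 : ℝ)..t, Real.exp (-2 * lam * s) * -∫ x, ⟪(Δ (v s)) x, Θ s x⟫ := by
    refine intervalIntegral.integral_congr fun s _ ↦ ?_
    rw [hv, sum_integral_inner_fderiv_eq_neg hΘ hν s]
  rw [hP] at hsum
  -- the absorption, integrated in time
  have iR : IntervalIntegrable (fun s ↦ Real.exp (-2 * lam * s) * -∫ x, ⟪(Δ (v s)) x, Θ s x⟫) volume 0 t := by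
    have h := IntervalIntegrable.sum Finset.univ fun i (_ : i ∈ Finset.univ) ↦ iP i
    refine (h.congr fun s _ ↦ ?_)
    simp only [Finset.sum_apply]
    rw [← Finset.mul_sum, hv, sum_integral_inner_fderiv_eq_neg hΘ hν s]
  have iHH : IntervalIntegrable (fun s ↦ Real.exp (-2 * lam * s) * ∑ i, ∑ j, ∫ x,
      ‖fderiv ℝ (fun y ↦ fderiv ℝ (v s) y (bE i)) x (bE j)‖ ^ 2) volume 0 t := by
    have h := IntervalIntegrable.sum Finset.univ fun i (_ : i ∈ Finset.univ) ↦ iH i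
    refine (h.congr fun s _ ↦ ?_)
    simp only [Finset.sum_apply]
    rw [← Finset.mul_sum]
  have iQ : IntervalIntegrable (fun s ↦ Real.exp (-2 * lam * s) * ∫ x, ‖Θ s x‖ ^ 2) volume 0 t := by
    rw [intervalIntegrable_iff_integrableOn_Ioc_of_le ht]
    exact integrableOn_weight_mul_sq_norm_test hΘ lam t
  have hbound : 2 * (∫ s in (0 : ℝ)..t, Real.exp (-2 * lam * s) * -∫ x, ⟪(Δ (v s)) x, Θ s x⟫) ≤
      ν * (∫ s in (0 : ℝ)..t, Real.exp (-2 * lam * s) * ∑ i, ∑ j, ∫ x,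
        ‖fderiv ℝ (fun y ↦ fderiv ℝ (v s) y (bE i)) x (bE j)‖ ^ 2) +
        (Module.finrank ℝ E : ℝ) / ν * ∫ s in (0 : ℝ)..t, Real.exp (-2 * lam * s) * ∫ x, ‖Θ s x‖ ^ 2 := by
    rw [← intervalIntegral.integral_const_mul, ← intervalIntegral.integral_const_mul,
      ← intervalIntegral.integral_const_mul,
      ← intervalIntegral.integral_add (iHH.const_mul _) (iQ.const_mul _)]
    refine intervalIntegral.integral_mono_on ht (iR.const_mul _) ((iHH.const_mul _).add (iQ.const_mul _))
      fun s _ ↦ ?_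
    have he : 0 < Real.exp (-2 * lam * s) := Real.exp_pos _
    have h := neg_two_mul_integral_inner_laplacian_le hΘ hν s
    have h' := mul_le_mul_of_nonneg_left h he.le
    rw [hv]
    calc 2 * (Real.exp (-2 * lam * s) * -∫ x, ⟪(Δ (heatDuhamelZero ν Θ s)) x, Θ s x⟫)
        = Real.exp (-2 * lam * s) * -(2 * ∫ x, ⟪(Δ (heatDuhamelZero ν Θ s)) x, Θ s x⟫) := by ring
      _ ≤ Real.exp (-2 * lam * s) * (ν * (∑ i, ∑ j, ∫ x, ‖fderiv ℝ (fun y ↦ fderiv ℝ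
            (heatDuhamelZero ν Θ s) y (stdOrthonormalBasis ℝ E i)) x (stdOrthonormalBasis ℝ E j)‖ ^ 2) +
          (Module.finrank ℝ E : ℝ) / ν * ∫ x, ‖Θ s x‖ ^ 2) := h'
      _ = ν * (Real.exp (-2 * lam * s) * ∑ i, ∑ j, ∫ x, ‖fderiv ℝ (fun y ↦ fderiv ℝ
            (heatDuhamelZero ν Θ s) y (stdOrthonormalBasis ℝ E i)) x (stdOrthonormalBasis ℝ E j)‖ ^ 2) +
          (Module.finrank ℝ E : ℝ) / ν * (Real.exp (-2 * lam * s) * ∫ x, ‖Θ s x‖ ^ 2) := by ring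
  linarith [hsum, hbound]

end Gradient

/-! ### `lintegral` forms at order `0` -/

section LintegralZero

/-- Joint smoothness of `v = heatDuhamelZero ν Θ` on `(0, ∞) × E`. [folklore] -/
theorem isSmoothSpaceTimeOn_heatDuhamelZero (hΘ : IsSpaceTimeTestOn (⊤ : Opens (ℝ × E)) Θ)
    (hν : 0 < ν) : IsSmoothSpaceTimeOn (Ioi 0) (heatDuhamelZero ν Θ) := by
  haveI : CompleteSpace F' := FiniteDimensional.complete ℝ F'
  have h1 : ContDiffOn ℝ ∞ (uncurry (heatDuhamelFwd ν Θ)) (Ioi 0 ×ˢ univ) :=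
    (contDiff_uncurry_heatDuhamelFwd hΘ hν).contDiffOn
  have h2 : ContDiffOn ℝ ∞ (uncurry (freeFlow ν (heatDuhamelFwd ν Θ 0))) (Ioi 0 ×ˢ univ) :=
    isSmoothSpaceTimeOn_freeFlow (isHeatAdmissible_heatDuhamelFwd hν hΘ 0) hν
  exact h1.sub h2

/-- Weighted time integrals of slice integrals of a nonnegative slab-integrable function, real
form versus `lintegral` form. [folklore] -/
theorem lintegral_Ioo_weight_lintegral_eq_ofReal {Φ : ℝ → E → ℝ} (hΦ : ∀ t x, 0 ≤ Φ t x)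
    {t : ℝ} (ht : 0 ≤ t)
    (hint : Integrable (fun q : E × ℝ ↦ Φ q.2 q.1)
      ((volume : Measure E).prod (volume.restrict (Ioc 0 t)))) (lam : ℝ) :
    ∫⁻ s in Ioo 0 t, ENNReal.ofReal (Real.exp (-2 * lam * s)) * ∫⁻ x, ENNReal.ofReal (Φ s x) =
      ENNReal.ofReal (∫ s in (0 : ℝ)..t, Real.exp (-2 * lam * s) * ∫ x, Φ s x) := by
  have h := lintegral_Ioo_lintegral_eq_ofReal (Φ := fun s x ↦ Real.exp (-2 * lam * s) * Φ s x)
    (fun s x ↦ mul_nonneg (Real.exp_pos _).le (hΦ s x)) ht (integrable_prod_weight_mul hint lam)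
  have hl : ∀ s, ∫⁻ x, ENNReal.ofReal (Real.exp (-2 * lam * s) * Φ s x) =
      ENNReal.ofReal (Real.exp (-2 * lam * s)) * ∫⁻ x, ENNReal.ofReal (Φ s x) := by
    intro s
    rw [← lintegral_const_mul' _ _ ENNReal.ofReal_ne_top]
    refine lintegral_congr fun x ↦ ?_
    rw [ENNReal.ofReal_mul (Real.exp_pos _).le]
  have hr : ∫ s in (0 : ℝ)..t, ∫ x, Real.exp (-2 * lam * s) * Φ s x =
      ∫ s in (0 : ℝ)..t, Real.exp (-2 * lam * s) * ∫ x, Φ s x := by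
    refine intervalIntegral.integral_congr fun s _ ↦ ?_
    exact integral_const_mul _ _
  simp_rw [hl] at h
  rw [h, hr]

omit [FiniteDimensional ℝ F'] in
/-- The weighted data functional in `lintegral` form. [folklore] -/
theorem lintegral_weight_enorm_sq_test_eq_ofReal (hΘ : IsSpaceTimeTestOn (⊤ : Opens (ℝ × E)) Θ)
    (lam : ℝ) {t : ℝ} (ht : 0 ≤ t) :
    ∫⁻ s in Ioo 0 t, ENNReal.ofReal (Real.exp (-2 * lam * s)) * ∫⁻ x, ‖Θ s x‖ₑ ^ 2 =
      ENNReal.ofReal (∫ s in (0 : ℝ)..t, Real.exp (-2 * lam * s) * ∫ x, ‖Θ s x‖ ^ 2) := by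
  have h := lintegral_Ioo_weight_lintegral_eq_ofReal (Φ := fun s x ↦ ‖Θ s x‖ ^ 2)
    (fun s x ↦ sq_nonneg _) ht (hΘ.integrable_prod_sq_norm 0 t) lam
  rw [← h]
  refine lintegral_congr fun s ↦ ?_
  simp only [enorm_sq_eq_ofReal]

/-- Slab integrability of `‖v‖²`, `‖∂ᵢv‖²`, `‖∂ⱼ∂ᵢv‖²` (as self-pairings). [folklore] -/
theorem integrable_prod_sq_norm_heatDuhamelZero (hΘ : IsSpaceTimeTestOn (⊤ : Opens (ℝ × E)) Θ)
    (hν : 0 < ν) (t : ℝ) :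
    Integrable (fun q : E × ℝ ↦ ‖heatDuhamelZero ν Θ q.2 q.1‖ ^ 2)
      ((volume : Measure E).prod (volume.restrict (Ioc 0 t))) := by
  refine (integrable_prod_inner_heatDuhamelZero hΘ hΘ hν t).congr (Eventually.of_forall fun q ↦ ?_)
  exact real_inner_self_eq_norm_sq _

/-- The weighted energy of `v` in `lintegral` form. [folklore] -/
theorem lintegral_weight_enorm_sq_heatDuhamelZero_eq_ofReal (hΘ : IsSpaceTimeTestOn (⊤ : Opens (ℝ × E)) Θ)
    (hν : 0 < ν) (lam : ℝ) {t : ℝ} (ht : 0 ≤ t) :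
    ∫⁻ s in Ioo 0 t, ENNReal.ofReal (Real.exp (-2 * lam * s)) * ∫⁻ x, ‖heatDuhamelZero ν Θ s x‖ₑ ^ 2 =
      ENNReal.ofReal (∫ s in (0 : ℝ)..t, Real.exp (-2 * lam * s) * ∫ x, ‖heatDuhamelZero ν Θ s x‖ ^ 2) := by
  have h := lintegral_Ioo_weight_lintegral_eq_ofReal (Φ := fun s x ↦ ‖heatDuhamelZero ν Θ s x‖ ^ 2)
    (fun s x ↦ sq_nonneg _) ht (integrable_prod_sq_norm_heatDuhamelZero hΘ hν t) lam
  rw [← h]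
  refine lintegral_congr fun s ↦ ?_
  simp only [enorm_sq_eq_ofReal]

/-- The weighted gradient energy of `v` in `lintegral` form. [folklore] -/
theorem lintegral_weight_sum_enorm_sq_fderiv_heatDuhamelZero_eq_ofReal
    (hΘ : IsSpaceTimeTestOn (⊤ : Opens (ℝ × E)) Θ) (hν : 0 < ν) (lam : ℝ) {t : ℝ} (ht : 0 ≤ t) :
    ∫⁻ s in Ioo 0 t, ENNReal.ofReal (Real.exp (-2 * lam * s)) *
        ∑ i, ∫⁻ x, ‖fderiv ℝ (heatDuhamelZero ν Θ s) x (stdOrthonormalBasis ℝ E i)‖ₑ ^ 2 =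
      ENNReal.ofReal (∫ s in (0 : ℝ)..t, Real.exp (-2 * lam * s) *
        ∑ i, ∫ x, ‖fderiv ℝ (heatDuhamelZero ν Θ s) x (stdOrthonormalBasis ℝ E i)‖ ^ 2) := by
  set bE := stdOrthonormalBasis ℝ E
  have hΘi : ∀ i, IsSpaceTimeTestOn (⊤ : Opens (ℝ × E)) (fun t y ↦ fderiv ℝ (Θ t) y (bE i)) :=
    fun i ↦ hΘ.fderiv_apply_top (bE i)
  have hvi : ∀ i s, heatDuhamelZero ν (fun t y ↦ fderiv ℝ (Θ t) y (bE i)) s =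
      fun x ↦ fderiv ℝ (heatDuhamelZero ν Θ s) x (bE i) :=
    fun i s ↦ (fderiv_heatDuhamelZero_eq hΘ hν s (bE i)).symm
  have hint : ∀ i, Integrable (fun q : E × ℝ ↦ ‖fderiv ℝ (heatDuhamelZero ν Θ q.2) q.1 (bE i)‖ ^ 2)
      ((volume : Measure E).prod (volume.restrict (Ioc 0 t))) := fun i ↦ by
    refine (integrable_prod_sq_norm_heatDuhamelZero (hΘi i) hν t).congr (Eventually.of_forall fun q ↦ ?_)
    dsimp only
    rw [hvi i q.2]
  have h := lintegral_Ioo_weight_lintegral_eq_ofReal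
    (Φ := fun s x ↦ ∑ i, ‖fderiv ℝ (heatDuhamelZero ν Θ s) x (bE i)‖ ^ 2)
    (fun s x ↦ Finset.sum_nonneg fun i _ ↦ sq_nonneg _) ht (integrable_finsetSum _ fun i _ ↦ hint i) lam
  have hlhs : ∀ s, ∑ i, ∫⁻ x, ‖fderiv ℝ (heatDuhamelZero ν Θ s) x (bE i)‖ₑ ^ 2 =
      ∫⁻ x, ENNReal.ofReal (∑ i, ‖fderiv ℝ (heatDuhamelZero ν Θ s) x (bE i)‖ ^ 2) := by
    intro s
    simp only [enorm_sq_eq_ofReal]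
    exact sum_lintegral_ofReal_eq _ (fun i x ↦ sq_nonneg _) fun i ↦
      (((contDiff_heatDuhamelZero hΘ hν s).continuous_fderiv (by simp)).clm_apply continuous_const).norm.pow 2
  have hrhs : ∀ s, ∫ x, ∑ i, ‖fderiv ℝ (heatDuhamelZero ν Θ s) x (bE i)‖ ^ 2 =
      ∑ i, ∫ x, ‖fderiv ℝ (heatDuhamelZero ν Θ s) x (bE i)‖ ^ 2 := by
    intro s
    refine integral_finsetSum _ fun i _ ↦ ?_
    have hm := ((isHeatAdmissible_heatDuhamelZero hΘ hν s).fderiv_apply (bE i)).memLp_two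
    exact (memLp_two_iff_integrable_sq_norm hm.1).1 hm
  simp_rw [hlhs]
  simp_rw [hrhs] at h
  exact h

/-- The weighted Hessian energy of `v` in `lintegral` form. [folklore] -/
theorem lintegral_weight_sum_enorm_sq_fderiv_fderiv_heatDuhamelZero_eq_ofReal
    (hΘ : IsSpaceTimeTestOn (⊤ : Opens (ℝ × E)) Θ) (hν : 0 < ν) (lam : ℝ) {t : ℝ} (ht : 0 ≤ t) :
    ∫⁻ s in Ioo 0 t, ENNReal.ofReal (Real.exp (-2 * lam * s)) * ∑ i, ∑ j, ∫⁻ x,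
        ‖fderiv ℝ (fun y ↦ fderiv ℝ (heatDuhamelZero ν Θ s) y (stdOrthonormalBasis ℝ E i)) x
          (stdOrthonormalBasis ℝ E j)‖ₑ ^ 2 =
      ENNReal.ofReal (∫ s in (0 : ℝ)..t, Real.exp (-2 * lam * s) * ∑ i, ∑ j, ∫ x,
        ‖fderiv ℝ (fun y ↦ fderiv ℝ (heatDuhamelZero ν Θ s) y (stdOrthonormalBasis ℝ E i)) x
          (stdOrthonormalBasis ℝ E j)‖ ^ 2) := by
  set bE := stdOrthonormalBasis ℝ E
  have hΘi : ∀ i, IsSpaceTimeTestOn (⊤ : Opens (ℝ × E)) (fun t y ↦ fderiv ℝ (Θ t) y (bE i)) :=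
    fun i ↦ hΘ.fderiv_apply_top (bE i)
  have hΘij : ∀ i j, IsSpaceTimeTestOn (⊤ : Opens (ℝ × E))
      (fun t y ↦ fderiv ℝ (fun z ↦ fderiv ℝ (Θ t) z (bE i)) y (bE j)) := fun i j ↦ (hΘi i).fderiv_apply_top (bE j)
  have hvij : ∀ i j s x, fderiv ℝ (fun y ↦ fderiv ℝ (heatDuhamelZero ν Θ s) y (bE i)) x (bE j) =
      heatDuhamelZero ν (fun t y ↦ fderiv ℝ (fun z ↦ fderiv ℝ (Θ t) z (bE i)) y (bE j)) s x := by
    intro i j s x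
    rw [fderiv_heatDuhamelZero_eq hΘ hν s (bE i), fderiv_heatDuhamelZero_apply (hΘi i) hν s x (bE j)]
  have hint : ∀ i j, Integrable (fun q : E × ℝ ↦
      ‖fderiv ℝ (fun y ↦ fderiv ℝ (heatDuhamelZero ν Θ q.2) y (bE i)) q.1 (bE j)‖ ^ 2)
      ((volume : Measure E).prod (volume.restrict (Ioc 0 t))) := fun i j ↦ by
    refine (integrable_prod_sq_norm_heatDuhamelZero (hΘij i j) hν t).congr (Eventually.of_forall fun q ↦ ?_)
    dsimp only
    rw [hvij i j q.2 q.1]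
  have h := lintegral_Ioo_weight_lintegral_eq_ofReal
    (Φ := fun s x ↦ ∑ i, ∑ j, ‖fderiv ℝ (fun y ↦ fderiv ℝ (heatDuhamelZero ν Θ s) y (bE i)) x (bE j)‖ ^ 2)
    (fun s x ↦ Finset.sum_nonneg fun i _ ↦ Finset.sum_nonneg fun j _ ↦ sq_nonneg _) ht
    (integrable_finsetSum _ fun i _ ↦ integrable_finsetSum _ fun j _ ↦ hint i j) lam
  have hcont : ∀ s i j, Continuous fun x ↦
      ‖fderiv ℝ (fun y ↦ fderiv ℝ (heatDuhamelZero ν Θ s) y (bE i)) x (bE j)‖ ^ 2 := by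
    intro s i j
    have h1 : ContDiff ℝ ∞ fun y ↦ fderiv ℝ (heatDuhamelZero ν Θ s) y (bE i) :=
      ((contDiff_heatDuhamelZero hΘ hν s).fderiv_right (m := ∞) (by norm_cast)).clm_apply contDiff_const
    exact ((h1.continuous_fderiv (by simp)).clm_apply continuous_const).norm.pow 2
  have hlhs : ∀ s, ∑ i, ∑ j, ∫⁻ x, ‖fderiv ℝ (fun y ↦ fderiv ℝ (heatDuhamelZero ν Θ s) y (bE i)) x (bE j)‖ₑ ^ 2 =
      ∫⁻ x, ENNReal.ofReal (∑ i, ∑ j, ‖fderiv ℝ (fun y ↦ fderiv ℝ (heatDuhamelZero ν Θ s) y (bE i)) x (bE j)‖ ^ 2) := by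
    intro s
    simp only [enorm_sq_eq_ofReal]
    rw [← sum_lintegral_ofReal_eq _ (fun i x ↦ Finset.sum_nonneg fun j _ ↦ sq_nonneg _)
      fun i ↦ continuous_finsetSum _ fun j _ ↦ hcont s i j]
    refine Finset.sum_congr rfl fun i _ ↦ ?_
    exact sum_lintegral_ofReal_eq _ (fun j x ↦ sq_nonneg _) fun j ↦ hcont s i j
  have hrhs : ∀ s, ∫ x, ∑ i, ∑ j, ‖fderiv ℝ (fun y ↦ fderiv ℝ (heatDuhamelZero ν Θ s) y (bE i)) x (bE j)‖ ^ 2 =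
      ∑ i, ∑ j, ∫ x, ‖fderiv ℝ (fun y ↦ fderiv ℝ (heatDuhamelZero ν Θ s) y (bE i)) x (bE j)‖ ^ 2 := by
    intro s
    have hij : ∀ i j, Integrable (fun x ↦ ‖fderiv ℝ (fun y ↦ fderiv ℝ (heatDuhamelZero ν Θ s) y (bE i)) x (bE j)‖ ^ 2) volume := by
      intro i j
      have hm := (((isHeatAdmissible_heatDuhamelZero hΘ hν s).fderiv_apply (bE i)).fderiv_apply (bE j)).memLp_two
      exact (memLp_two_iff_integrable_sq_norm hm.1).1 hm
    rw [integral_finsetSum _ fun i _ ↦ integrable_finsetSum _ fun j _ ↦ hij i j]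
    refine Finset.sum_congr rfl fun i _ ↦ ?_
    exact integral_finsetSum _ fun j _ ↦ hij i j
  simp_rw [hlhs]
  simp_rw [hrhs] at h
  exact h

/-- **Weighted sup energy, order `0`**: `e^{-2λt}‖v(t)‖₂² ≤ λ⁻¹ ∫₀ᵗ e^{-2λs}‖Θ‖₂²` (`λ > 0`).
[cite: Evans2010, §7.1.2, Thm. 2] -/
theorem weight_mul_lintegral_enorm_sq_heatDuhamelZero_le (hΘ : IsSpaceTimeTestOn (⊤ : Opens (ℝ × E)) Θ)
    (hν : 0 < ν) {lam : ℝ} (hlam : 0 < lam) {t : ℝ} (ht : 0 ≤ t) :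
    ENNReal.ofReal (Real.exp (-2 * lam * t)) * ∫⁻ x, ‖heatDuhamelZero ν Θ t x‖ₑ ^ 2 ≤
      ENNReal.ofReal lam⁻¹ * ∫⁻ s in Ioo 0 t, ENNReal.ofReal (Real.exp (-2 * lam * s)) * ∫⁻ x, ‖Θ s x‖ₑ ^ 2 := by
  have h := weighted_energy_le_heatDuhamelZero hΘ hν hlam ht
  have hA0 : 0 ≤ lam * (∫ s in (0 : ℝ)..t, Real.exp (-2 * lam * s) * ∫ x, ‖heatDuhamelZero ν Θ s x‖ ^ 2) :=
    mul_nonneg hlam.le (intervalIntegral.integral_nonneg ht fun s _ ↦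
      mul_nonneg (Real.exp_pos _).le (integral_nonneg fun _ ↦ sq_nonneg _))
  have hD0 : 0 ≤ 2 * ν * (∫ s in (0 : ℝ)..t, Real.exp (-2 * lam * s) *
      ∑ i, ∫ x, ‖fderiv ℝ (heatDuhamelZero ν Θ s) x (stdOrthonormalBasis ℝ E i)‖ ^ 2) :=
    mul_nonneg (by positivity) (intervalIntegral.integral_nonneg ht fun s _ ↦
      mul_nonneg (Real.exp_pos _).le (Finset.sum_nonneg fun i _ ↦ integral_nonneg fun _ ↦ sq_nonneg _))
  rw [lintegral_weight_enorm_sq_test_eq_ofReal hΘ lam ht,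
    lintegral_enorm_sq_eq_ofReal (isHeatAdmissible_heatDuhamelZero hΘ hν t).memLp_two,
    ← ENNReal.ofReal_mul (Real.exp_pos _).le, ← ENNReal.ofReal_mul (inv_pos.2 hlam).le]
  exact ENNReal.ofReal_le_ofReal (by linarith)

/-- **Weighted energy, order `0`**: `∫₀ᵗ e^{-2λs}‖v‖₂² ≤ λ⁻² ∫₀ᵗ e^{-2λs}‖Θ‖₂²` (`λ > 0`).
[cite: Evans2010, §7.1.2, Thm. 2] -/
theorem lintegral_weight_enorm_sq_heatDuhamelZero_le (hΘ : IsSpaceTimeTestOn (⊤ : Opens (ℝ × E)) Θ)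
    (hν : 0 < ν) {lam : ℝ} (hlam : 0 < lam) {t : ℝ} (ht : 0 ≤ t) :
    ∫⁻ s in Ioo 0 t, ENNReal.ofReal (Real.exp (-2 * lam * s)) * ∫⁻ x, ‖heatDuhamelZero ν Θ s x‖ₑ ^ 2 ≤
      ENNReal.ofReal (lam⁻¹ ^ 2) * ∫⁻ s in Ioo 0 t, ENNReal.ofReal (Real.exp (-2 * lam * s)) * ∫⁻ x, ‖Θ s x‖ₑ ^ 2 := by
  have h := weighted_energy_le_heatDuhamelZero hΘ hν hlam ht
  have hE0 : 0 ≤ Real.exp (-2 * lam * t) * (∫ x, ‖heatDuhamelZero ν Θ t x‖ ^ 2) :=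
    mul_nonneg (Real.exp_pos _).le (integral_nonneg fun _ ↦ sq_nonneg _)
  have hD0 : 0 ≤ 2 * ν * (∫ s in (0 : ℝ)..t, Real.exp (-2 * lam * s) *
      ∑ i, ∫ x, ‖fderiv ℝ (heatDuhamelZero ν Θ s) x (stdOrthonormalBasis ℝ E i)‖ ^ 2) :=
    mul_nonneg (by positivity) (intervalIntegral.integral_nonneg ht fun s _ ↦
      mul_nonneg (Real.exp_pos _).le (Finset.sum_nonneg fun i _ ↦ integral_nonneg fun _ ↦ sq_nonneg _))
  set A := ∫ s in (0 : ℝ)..t, Real.exp (-2 * lam * s) * ∫ x, ‖heatDuhamelZero ν Θ s x‖ ^ 2 with hA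
  set Q := ∫ s in (0 : ℝ)..t, Real.exp (-2 * lam * s) * ∫ x, ‖Θ s x‖ ^ 2 with hQ
  have hAQ : lam * A ≤ lam⁻¹ * Q := by linarith
  have hAQ' : A ≤ lam⁻¹ ^ 2 * Q := by
    have h1 : A = lam⁻¹ * (lam * A) := by field_simp
    rw [h1, sq, mul_assoc]
    exact mul_le_mul_of_nonneg_left hAQ (inv_pos.2 hlam).le
  rw [lintegral_weight_enorm_sq_test_eq_ofReal hΘ lam ht,
    lintegral_weight_enorm_sq_heatDuhamelZero_eq_ofReal hΘ hν lam ht,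
    ← ENNReal.ofReal_mul (by positivity)]
  exact ENNReal.ofReal_le_ofReal hAQ'

/-- **Weighted gradient energy, order `0`**: `∫₀ᵗ e^{-2λs}Σᵢ‖∂ᵢv‖₂² ≤ (λ⁻¹/(2ν)) ∫₀ᵗ e^{-2λs}‖Θ‖₂²`
(`λ > 0`). [cite: Evans2010, §7.1.2, Thm. 2] -/
theorem lintegral_weight_sum_enorm_sq_fderiv_heatDuhamelZero_le
    (hΘ : IsSpaceTimeTestOn (⊤ : Opens (ℝ × E)) Θ) (hν : 0 < ν) {lam : ℝ} (hlam : 0 < lam)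
    {t : ℝ} (ht : 0 ≤ t) :
    ∫⁻ s in Ioo 0 t, ENNReal.ofReal (Real.exp (-2 * lam * s)) *
        ∑ i, ∫⁻ x, ‖fderiv ℝ (heatDuhamelZero ν Θ s) x (stdOrthonormalBasis ℝ E i)‖ₑ ^ 2 ≤
      ENNReal.ofReal (lam⁻¹ / (2 * ν)) *
        ∫⁻ s in Ioo 0 t, ENNReal.ofReal (Real.exp (-2 * lam * s)) * ∫⁻ x, ‖Θ s x‖ₑ ^ 2 := by
  have h := weighted_energy_le_heatDuhamelZero hΘ hν hlam ht
  have hE0 : 0 ≤ Real.exp (-2 * lam * t) * (∫ x, ‖heatDuhamelZero ν Θ t x‖ ^ 2) :=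
    mul_nonneg (Real.exp_pos _).le (integral_nonneg fun _ ↦ sq_nonneg _)
  have hA0 : 0 ≤ lam * (∫ s in (0 : ℝ)..t, Real.exp (-2 * lam * s) * ∫ x, ‖heatDuhamelZero ν Θ s x‖ ^ 2) :=
    mul_nonneg hlam.le (intervalIntegral.integral_nonneg ht fun s _ ↦
      mul_nonneg (Real.exp_pos _).le (integral_nonneg fun _ ↦ sq_nonneg _))
  set D := ∫ s in (0 : ℝ)..t, Real.exp (-2 * lam * s) *
      ∑ i, ∫ x, ‖fderiv ℝ (heatDuhamelZero ν Θ s) x (stdOrthonormalBasis ℝ E i)‖ ^ 2 with hD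
  set Q := ∫ s in (0 : ℝ)..t, Real.exp (-2 * lam * s) * ∫ x, ‖Θ s x‖ ^ 2 with hQ
  have hDQ : 2 * ν * D ≤ lam⁻¹ * Q := by linarith
  have hDQ' : D ≤ lam⁻¹ / (2 * ν) * Q := by
    have h2ν : 0 < 2 * ν := by positivity
    rw [div_mul_eq_mul_div, le_div_iff₀ h2ν]
    linarith
  rw [lintegral_weight_enorm_sq_test_eq_ofReal hΘ lam ht,
    lintegral_weight_sum_enorm_sq_fderiv_heatDuhamelZero_eq_ofReal hΘ hν lam ht,
    ← ENNReal.ofReal_mul (by positivity)]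
  exact ENNReal.ofReal_le_ofReal hDQ'

/-- **Weighted maximal regularity, order `0`**:
`∫₀ᵗ e^{-2λs}Σᵢⱼ‖∂ⱼ∂ᵢv‖₂² ≤ (n/ν²) ∫₀ᵗ e^{-2λs}‖Θ‖₂²` (`λ ≥ 0`; `T`- and `λ`-independent constant).
[cite: Evans2010, §7.1.2, Thm. 2] -/
theorem lintegral_weight_sum_enorm_sq_fderiv_fderiv_heatDuhamelZero_le
    (hΘ : IsSpaceTimeTestOn (⊤ : Opens (ℝ × E)) Θ) (hν : 0 < ν) {lam : ℝ} (hlam : 0 ≤ lam)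
    {t : ℝ} (ht : 0 ≤ t) :
    ∫⁻ s in Ioo 0 t, ENNReal.ofReal (Real.exp (-2 * lam * s)) * ∑ i, ∑ j, ∫⁻ x,
        ‖fderiv ℝ (fun y ↦ fderiv ℝ (heatDuhamelZero ν Θ s) y (stdOrthonormalBasis ℝ E i)) x
          (stdOrthonormalBasis ℝ E j)‖ₑ ^ 2 ≤
      ENNReal.ofReal ((Module.finrank ℝ E : ℝ) / ν ^ 2) *
        ∫⁻ s in Ioo 0 t, ENNReal.ofReal (Real.exp (-2 * lam * s)) * ∫⁻ x, ‖Θ s x‖ₑ ^ 2 := by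
  have h := weighted_gradient_energy_le_heatDuhamelZero hΘ hν lam ht
  have hG0 : 0 ≤ Real.exp (-2 * lam * t) *
      (∑ i, ∫ x, ‖fderiv ℝ (heatDuhamelZero ν Θ t) x (stdOrthonormalBasis ℝ E i)‖ ^ 2) :=
    mul_nonneg (Real.exp_pos _).le (Finset.sum_nonneg fun i _ ↦ integral_nonneg fun _ ↦ sq_nonneg _)
  have hG1 : 0 ≤ 2 * lam * (∫ s in (0 : ℝ)..t, Real.exp (-2 * lam * s) *
      ∑ i, ∫ x, ‖fderiv ℝ (heatDuhamelZero ν Θ s) x (stdOrthonormalBasis ℝ E i)‖ ^ 2) :=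
    mul_nonneg (by positivity) (intervalIntegral.integral_nonneg ht fun s _ ↦
      mul_nonneg (Real.exp_pos _).le (Finset.sum_nonneg fun i _ ↦ integral_nonneg fun _ ↦ sq_nonneg _))
  set H := ∫ s in (0 : ℝ)..t, Real.exp (-2 * lam * s) * ∑ i, ∑ j, ∫ x,
      ‖fderiv ℝ (fun y ↦ fderiv ℝ (heatDuhamelZero ν Θ s) y (stdOrthonormalBasis ℝ E i)) x
        (stdOrthonormalBasis ℝ E j)‖ ^ 2 with hH
  set Q := ∫ s in (0 : ℝ)..t, Real.exp (-2 * lam * s) * ∫ x, ‖Θ s x‖ ^ 2 with hQ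
  have hHQ : ν * H ≤ (Module.finrank ℝ E : ℝ) / ν * Q := by linarith
  have hHQ' : H ≤ (Module.finrank ℝ E : ℝ) / ν ^ 2 * Q := by
    have h1 : H = ν⁻¹ * (ν * H) := by field_simp
    have h2 : (Module.finrank ℝ E : ℝ) / ν ^ 2 * Q = ν⁻¹ * ((Module.finrank ℝ E : ℝ) / ν * Q) := by
      field_simp
    rw [h1, h2]
    exact mul_le_mul_of_nonneg_left hHQ (inv_pos.2 hν).le
  rw [lintegral_weight_enorm_sq_test_eq_ofReal hΘ lam ht,
    lintegral_weight_sum_enorm_sq_fderiv_fderiv_heatDuhamelZero_eq_ofReal hΘ hν lam ht,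
    ← ENNReal.ofReal_mul (by positivity)]
  exact ENNReal.ofReal_le_ofReal hHQ'

/-- **Weighted gradient at a time, order `0`**: `e^{-2λt}Σᵢ‖∂ᵢv(t)‖₂² ≤ (n/ν) ∫₀ᵗ e^{-2λs}‖Θ‖₂²`
(`λ ≥ 0`). [cite: Evans2010, §7.1.2, Thm. 2] -/
theorem weight_mul_sum_lintegral_enorm_sq_fderiv_heatDuhamelZero_le
    (hΘ : IsSpaceTimeTestOn (⊤ : Opens (ℝ × E)) Θ) (hν : 0 < ν) {lam : ℝ} (hlam : 0 ≤ lam)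
    {t : ℝ} (ht : 0 ≤ t) :
    ENNReal.ofReal (Real.exp (-2 * lam * t)) *
        ∑ i, ∫⁻ x, ‖fderiv ℝ (heatDuhamelZero ν Θ t) x (stdOrthonormalBasis ℝ E i)‖ₑ ^ 2 ≤
      ENNReal.ofReal ((Module.finrank ℝ E : ℝ) / ν) *
        ∫⁻ s in Ioo 0 t, ENNReal.ofReal (Real.exp (-2 * lam * s)) * ∫⁻ x, ‖Θ s x‖ₑ ^ 2 := by
  have h := weighted_gradient_energy_le_heatDuhamelZero hΘ hν lam ht
  have hG1 : 0 ≤ 2 * lam * (∫ s in (0 : ℝ)..t, Real.exp (-2 * lam * s) *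
      ∑ i, ∫ x, ‖fderiv ℝ (heatDuhamelZero ν Θ s) x (stdOrthonormalBasis ℝ E i)‖ ^ 2) :=
    mul_nonneg (by positivity) (intervalIntegral.integral_nonneg ht fun s _ ↦
      mul_nonneg (Real.exp_pos _).le (Finset.sum_nonneg fun i _ ↦ integral_nonneg fun _ ↦ sq_nonneg _))
  have hH0 : 0 ≤ ν * (∫ s in (0 : ℝ)..t, Real.exp (-2 * lam * s) * ∑ i, ∑ j, ∫ x,
      ‖fderiv ℝ (fun y ↦ fderiv ℝ (heatDuhamelZero ν Θ s) y (stdOrthonormalBasis ℝ E i)) x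
        (stdOrthonormalBasis ℝ E j)‖ ^ 2) :=
    mul_nonneg hν.le (intervalIntegral.integral_nonneg ht fun s _ ↦
      mul_nonneg (Real.exp_pos _).le (Finset.sum_nonneg fun i _ ↦ Finset.sum_nonneg fun j _ ↦
        integral_nonneg fun _ ↦ sq_nonneg _))
  have hconv : ∑ i, ∫⁻ x, ‖fderiv ℝ (heatDuhamelZero ν Θ t) x (stdOrthonormalBasis ℝ E i)‖ₑ ^ 2 =
      ENNReal.ofReal (∑ i, ∫ x, ‖fderiv ℝ (heatDuhamelZero ν Θ t) x (stdOrthonormalBasis ℝ E i)‖ ^ 2) := by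
    rw [ENNReal.ofReal_sum_of_nonneg fun i _ ↦ integral_nonneg fun _ ↦ sq_nonneg _]
    refine Finset.sum_congr rfl fun i _ ↦ ?_
    exact lintegral_enorm_sq_eq_ofReal (((isHeatAdmissible_heatDuhamelZero hΘ hν t).fderiv_apply
      (stdOrthonormalBasis ℝ E i)).memLp_two)
  rw [hconv, lintegral_weight_enorm_sq_test_eq_ofReal hΘ lam ht,
    ← ENNReal.ofReal_mul (Real.exp_pos _).le, ← ENNReal.ofReal_mul (by positivity)]
  exact ENNReal.ofReal_le_ofReal (by linarith)

end LintegralZero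

/-! ### The estimates at every Sobolev order -/

section AllOrders

omit [FiniteDimensional ℝ F'] in
/-- The weighted time integral of the energies splits along the recursion
`E_{k+1}(F) = ∫‖F‖² + Σₗ E_k(∂ₗF)` (field jointly smooth on the open time set `S`). [folklore] -/
theorem lintegral_weight_sobolevEnergy_succ_slice {S : Set ℝ} (hS : IsOpen S) {F : ℝ → E → F'}
    (hF : IsSmoothSpaceTimeOn S F) (k : ℕ) (lam : ℝ) :
    ∫⁻ s in S, ENNReal.ofReal (Real.exp (-2 * lam * s)) * sobolevEnergy (k + 1) (F s) =
      (∫⁻ s in S, ENNReal.ofReal (Real.exp (-2 * lam * s)) * ∫⁻ x, ‖F s x‖ₑ ^ 2) +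
        ∑ l, ∫⁻ s in S, ENNReal.ofReal (Real.exp (-2 * lam * s)) *
          sobolevEnergy k (fun y ↦ fderiv ℝ (F s) y (stdOrthonormalBasis ℝ E l)) := by
  have hw : Measurable fun s : ℝ ↦ ENNReal.ofReal (Real.exp (-2 * lam * s)) :=
    (Real.continuous_exp.comp (continuous_const.mul continuous_id)).measurable.ennreal_ofReal
  have hA : AEMeasurable (fun s ↦ ENNReal.ofReal (Real.exp (-2 * lam * s)) * ∫⁻ x, ‖F s x‖ₑ ^ 2)
      (volume.restrict S) := by
    have h := aemeasurable_sobolevEnergy_slice hS 0 hF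
    simp only [sobolevEnergy_zero_left] at h
    exact hw.aemeasurable.mul h
  have hB : ∀ l, AEMeasurable (fun s ↦ ENNReal.ofReal (Real.exp (-2 * lam * s)) *
      sobolevEnergy k (fun y ↦ fderiv ℝ (F s) y (stdOrthonormalBasis ℝ E l))) (volume.restrict S) :=
    fun l ↦ hw.aemeasurable.mul (aemeasurable_sobolevEnergy_slice hS k
      (hF.isSmoothSpaceTimeOn_fderiv_apply hS _))
  simp only [sobolevEnergy_succ, mul_add, Finset.mul_sum]
  rw [lintegral_add_left' hA, lintegral_finsetSum' _ fun l _ ↦ hB l]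

/-- **Weighted sup energy at every order**: `e^{-2λt}E_k(v(t)) ≤ λ⁻¹ ∫₀ᵗ e^{-2λs}E_k(Θ)` (`λ > 0`).
[cite: Evans2010, §7.1.2, Thm. 2] -/
theorem weight_mul_sobolevEnergy_heatDuhamelZero_le (hν : 0 < ν) {lam : ℝ} (hlam : 0 < lam) (k : ℕ) :
    ∀ {Θ : ℝ → E → F'}, IsSpaceTimeTestOn (⊤ : Opens (ℝ × E)) Θ → ∀ {t : ℝ}, 0 ≤ t →
      ENNReal.ofReal (Real.exp (-2 * lam * t)) * sobolevEnergy k (heatDuhamelZero ν Θ t) ≤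
        ENNReal.ofReal lam⁻¹ *
          ∫⁻ s in Ioo 0 t, ENNReal.ofReal (Real.exp (-2 * lam * s)) * sobolevEnergy k (Θ s) := by
  induction k with
  | zero =>
    intro Θ hΘ t ht
    simp only [sobolevEnergy_zero_left]
    exact weight_mul_lintegral_enorm_sq_heatDuhamelZero_le hΘ hν hlam ht
  | succ k ih =>
    intro Θ hΘ t ht
    have hΘl : ∀ l, IsSpaceTimeTestOn (⊤ : Opens (ℝ × E)) (fun s y ↦ fderiv ℝ (Θ s) y (stdOrthonormalBasis ℝ E l)) :=
      fun l ↦ hΘ.fderiv_apply_top _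
    rw [lintegral_weight_sobolevEnergy_succ_slice isOpen_Ioo (hΘ.isSmoothSpaceTimeOn _),
      mul_add, Finset.mul_sum, sobolevEnergy_succ, mul_add, Finset.mul_sum]
    refine add_le_add ?_ (Finset.sum_le_sum fun l _ ↦ ?_)
    · exact weight_mul_lintegral_enorm_sq_heatDuhamelZero_le hΘ hν hlam ht
    · rw [fderiv_heatDuhamelZero_eq hΘ hν t]
      exact ih (hΘl l) ht

/-- **Weighted energy at every order**: `∫₀ᵗ e^{-2λs}E_k(v) ≤ λ⁻² ∫₀ᵗ e^{-2λs}E_k(Θ)` (`λ > 0`).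
[cite: Evans2010, §7.1.2, Thm. 2] -/
theorem lintegral_weight_sobolevEnergy_heatDuhamelZero_le (hν : 0 < ν) {lam : ℝ} (hlam : 0 < lam) (k : ℕ) :
    ∀ {Θ : ℝ → E → F'}, IsSpaceTimeTestOn (⊤ : Opens (ℝ × E)) Θ → ∀ {t : ℝ}, 0 ≤ t →
      ∫⁻ s in Ioo 0 t, ENNReal.ofReal (Real.exp (-2 * lam * s)) * sobolevEnergy k (heatDuhamelZero ν Θ s) ≤
        ENNReal.ofReal (lam⁻¹ ^ 2) *
          ∫⁻ s in Ioo 0 t, ENNReal.ofReal (Real.exp (-2 * lam * s)) * sobolevEnergy k (Θ s) := by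
  induction k with
  | zero =>
    intro Θ hΘ t ht
    simp only [sobolevEnergy_zero_left]
    exact lintegral_weight_enorm_sq_heatDuhamelZero_le hΘ hν hlam ht
  | succ k ih =>
    intro Θ hΘ t ht
    have hΘl : ∀ l, IsSpaceTimeTestOn (⊤ : Opens (ℝ × E)) (fun s y ↦ fderiv ℝ (Θ s) y (stdOrthonormalBasis ℝ E l)) :=
      fun l ↦ hΘ.fderiv_apply_top _
    have hV : IsSmoothSpaceTimeOn (Ioo 0 t) (heatDuhamelZero ν Θ) :=
      (isSmoothSpaceTimeOn_heatDuhamelZero hΘ hν).mono Ioo_subset_Ioi_self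
    rw [lintegral_weight_sobolevEnergy_succ_slice isOpen_Ioo (hΘ.isSmoothSpaceTimeOn _),
      lintegral_weight_sobolevEnergy_succ_slice isOpen_Ioo hV, mul_add, Finset.mul_sum]
    refine add_le_add ?_ (Finset.sum_le_sum fun l _ ↦ ?_)
    · exact lintegral_weight_enorm_sq_heatDuhamelZero_le hΘ hν hlam ht
    · simp only [fderiv_heatDuhamelZero_eq hΘ hν]
      exact ih (hΘl l) ht

/-- **Weighted gradient energy at every order**:
`∫₀ᵗ e^{-2λs}Σᵢ E_k(∂ᵢv) ≤ (λ⁻¹/(2ν)) ∫₀ᵗ e^{-2λs}E_k(Θ)` (`λ > 0`). [cite: Evans2010, §7.1.2, Thm. 2] -/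
theorem lintegral_weight_sum_sobolevEnergy_fderiv_heatDuhamelZero_le (hν : 0 < ν) {lam : ℝ}
    (hlam : 0 < lam) (k : ℕ) :
    ∀ {Θ : ℝ → E → F'}, IsSpaceTimeTestOn (⊤ : Opens (ℝ × E)) Θ → ∀ {t : ℝ}, 0 ≤ t →
      ∫⁻ s in Ioo 0 t, ENNReal.ofReal (Real.exp (-2 * lam * s)) * ∑ i, sobolevEnergy k
          (fun x ↦ fderiv ℝ (heatDuhamelZero ν Θ s) x (stdOrthonormalBasis ℝ E i)) ≤
        ENNReal.ofReal (lam⁻¹ / (2 * ν)) *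
          ∫⁻ s in Ioo 0 t, ENNReal.ofReal (Real.exp (-2 * lam * s)) * sobolevEnergy k (Θ s) := by
  induction k with
  | zero =>
    intro Θ hΘ t ht
    simp only [sobolevEnergy_zero_left]
    exact lintegral_weight_sum_enorm_sq_fderiv_heatDuhamelZero_le hΘ hν hlam ht
  | succ k ih =>
    intro Θ hΘ t ht
    set bE := stdOrthonormalBasis ℝ E
    set w : ℝ → ℝ≥0∞ := fun s ↦ ENNReal.ofReal (Real.exp (-2 * lam * s)) with hw
    have hwm : Measurable w :=
      (Real.continuous_exp.comp (continuous_const.mul continuous_id)).measurable.ennreal_ofReal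
    have hΘl : ∀ l, IsSpaceTimeTestOn (⊤ : Opens (ℝ × E)) (fun s y ↦ fderiv ℝ (Θ s) y (bE l)) :=
      fun l ↦ hΘ.fderiv_apply_top _
    have hV : IsSmoothSpaceTimeOn (Ioo 0 t) (heatDuhamelZero ν Θ) :=
      (isSmoothSpaceTimeOn_heatDuhamelZero hΘ hν).mono Ioo_subset_Ioi_self
    have hVi : ∀ i, IsSmoothSpaceTimeOn (Ioo 0 t) (fun s x ↦ fderiv ℝ (heatDuhamelZero ν Θ s) x (bE i)) :=
      fun i ↦ hV.isSmoothSpaceTimeOn_fderiv_apply isOpen_Ioo _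
    have hmeas0 : ∀ i, AEMeasurable (fun s ↦ ∫⁻ x, ‖fderiv ℝ (heatDuhamelZero ν Θ s) x (bE i)‖ₑ ^ 2)
        (volume.restrict (Ioo 0 t)) := fun i ↦ by
      simpa using aemeasurable_sobolevEnergy_slice isOpen_Ioo 0 (hVi i)
    have hmeask : ∀ i l, AEMeasurable (fun s ↦ sobolevEnergy k
        (fun x ↦ fderiv ℝ (fun y ↦ fderiv ℝ (heatDuhamelZero ν Θ s) y (bE i)) x (bE l)))
        (volume.restrict (Ioo 0 t)) :=
      fun i l ↦ aemeasurable_sobolevEnergy_slice isOpen_Ioo k ((hVi i).isSmoothSpaceTimeOn_fderiv_apply isOpen_Ioo _)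
    rw [lintegral_weight_sobolevEnergy_succ_slice isOpen_Ioo (hΘ.isSmoothSpaceTimeOn _),
      mul_add, Finset.mul_sum]
    simp only [sobolevEnergy_succ]
    have hsplit : ∫⁻ s in Ioo 0 t, w s * ∑ i, ((∫⁻ x, ‖fderiv ℝ (heatDuhamelZero ν Θ s) x (bE i)‖ₑ ^ 2) +
        ∑ l, sobolevEnergy k (fun x ↦ fderiv ℝ
          (fun y ↦ fderiv ℝ (heatDuhamelZero ν Θ s) y (bE i)) x (bE l))) =
        (∫⁻ s in Ioo 0 t, w s * ∑ i, ∫⁻ x, ‖fderiv ℝ (heatDuhamelZero ν Θ s) x (bE i)‖ₑ ^ 2) +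
          ∑ l, ∫⁻ s in Ioo 0 t, w s * ∑ i, sobolevEnergy k (fun x ↦ fderiv ℝ
            (fun y ↦ fderiv ℝ (heatDuhamelZero ν Θ s) y (bE i)) x (bE l)) := by
      have hm1 : AEMeasurable (fun s ↦ w s * ∑ i, ∫⁻ x, ‖fderiv ℝ (heatDuhamelZero ν Θ s) x (bE i)‖ₑ ^ 2)
          (volume.restrict (Ioo 0 t)) :=
        hwm.aemeasurable.mul (Finset.aemeasurable_fun_sum _ fun i _ ↦ hmeas0 i)
      have hm2 : ∀ l, AEMeasurable (fun s ↦ w s * ∑ i, sobolevEnergy k (fun x ↦ fderiv ℝ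
          (fun y ↦ fderiv ℝ (heatDuhamelZero ν Θ s) y (bE i)) x (bE l))) (volume.restrict (Ioo 0 t)) :=
        fun l ↦ hwm.aemeasurable.mul (Finset.aemeasurable_fun_sum _ fun i _ ↦ hmeask i l)
      rw [← lintegral_finsetSum' _ fun l _ ↦ hm2 l, ← lintegral_add_left' hm1]
      refine lintegral_congr fun s ↦ ?_
      rw [Finset.sum_add_distrib, mul_add]
      congr 1
      rw [Finset.sum_comm, Finset.mul_sum]
    rw [hsplit]
    refine add_le_add ?_ (Finset.sum_le_sum fun l _ ↦ ?_)
    · exact lintegral_weight_sum_enorm_sq_fderiv_heatDuhamelZero_le hΘ hν hlam ht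
    · have heq : ∀ s i, (fun x ↦ fderiv ℝ (fun y ↦ fderiv ℝ (heatDuhamelZero ν Θ s) y (bE i)) x (bE l)) =
          fun x ↦ fderiv ℝ (heatDuhamelZero ν (fun s y ↦ fderiv ℝ (Θ s) y (bE l)) s) x (bE i) := by
        intro s i
        rw [(isHeatAdmissible_heatDuhamelZero hΘ hν s).fderiv_fderiv_comm (bE i) (bE l),
          fderiv_heatDuhamelZero_eq hΘ hν s (bE l)]
      simp only [heq]
      exact ih (hΘl l) ht

/-- **Weighted maximal regularity at every order**:
`∫₀ᵗ e^{-2λs}Σᵢⱼ E_k(∂ⱼ∂ᵢv) ≤ (n/ν²) ∫₀ᵗ e^{-2λs}E_k(Θ)` (`λ ≥ 0`; constant independent of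
`λ`, `t`, `k`). [cite: Evans2010, §7.1.2, Thm. 2] -/
theorem lintegral_weight_sum_sobolevEnergy_fderiv_fderiv_heatDuhamelZero_le (hν : 0 < ν) {lam : ℝ}
    (hlam : 0 ≤ lam) (k : ℕ) :
    ∀ {Θ : ℝ → E → F'}, IsSpaceTimeTestOn (⊤ : Opens (ℝ × E)) Θ → ∀ {t : ℝ}, 0 ≤ t →
      ∫⁻ s in Ioo 0 t, ENNReal.ofReal (Real.exp (-2 * lam * s)) * ∑ i, ∑ j, sobolevEnergy k
          (fun x ↦ fderiv ℝ (fun y ↦ fderiv ℝ (heatDuhamelZero ν Θ s) y (stdOrthonormalBasis ℝ E i)) x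
            (stdOrthonormalBasis ℝ E j)) ≤
        ENNReal.ofReal ((Module.finrank ℝ E : ℝ) / ν ^ 2) *
          ∫⁻ s in Ioo 0 t, ENNReal.ofReal (Real.exp (-2 * lam * s)) * sobolevEnergy k (Θ s) := by
  induction k with
  | zero =>
    intro Θ hΘ t ht
    simp only [sobolevEnergy_zero_left]
    exact lintegral_weight_sum_enorm_sq_fderiv_fderiv_heatDuhamelZero_le hΘ hν hlam ht
  | succ k ih =>
    intro Θ hΘ t ht
    set bE := stdOrthonormalBasis ℝ E
    set w : ℝ → ℝ≥0∞ := fun s ↦ ENNReal.ofReal (Real.exp (-2 * lam * s)) with hw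
    have hwm : Measurable w :=
      (Real.continuous_exp.comp (continuous_const.mul continuous_id)).measurable.ennreal_ofReal
    have hΘl : ∀ l, IsSpaceTimeTestOn (⊤ : Opens (ℝ × E)) (fun s y ↦ fderiv ℝ (Θ s) y (bE l)) :=
      fun l ↦ hΘ.fderiv_apply_top _
    have hV : IsSmoothSpaceTimeOn (Ioo 0 t) (heatDuhamelZero ν Θ) :=
      (isSmoothSpaceTimeOn_heatDuhamelZero hΘ hν).mono Ioo_subset_Ioi_self
    have hVij : ∀ i j, IsSmoothSpaceTimeOn (Ioo 0 t) (fun s x ↦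
        fderiv ℝ (fun y ↦ fderiv ℝ (heatDuhamelZero ν Θ s) y (bE i)) x (bE j)) := fun i j ↦
      (hV.isSmoothSpaceTimeOn_fderiv_apply isOpen_Ioo _).isSmoothSpaceTimeOn_fderiv_apply isOpen_Ioo _
    have hmeas0 : ∀ i j, AEMeasurable (fun s ↦ ∫⁻ x,
        ‖fderiv ℝ (fun y ↦ fderiv ℝ (heatDuhamelZero ν Θ s) y (bE i)) x (bE j)‖ₑ ^ 2)
        (volume.restrict (Ioo 0 t)) := fun i j ↦ by
      simpa using aemeasurable_sobolevEnergy_slice isOpen_Ioo 0 (hVij i j)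
    have hmeask : ∀ i j l, AEMeasurable (fun s ↦ sobolevEnergy k (fun x ↦ fderiv ℝ
        (fun z ↦ fderiv ℝ (fun y ↦ fderiv ℝ (heatDuhamelZero ν Θ s) y (bE i)) z (bE j)) x (bE l)))
        (volume.restrict (Ioo 0 t)) :=
      fun i j l ↦ aemeasurable_sobolevEnergy_slice isOpen_Ioo k ((hVij i j).isSmoothSpaceTimeOn_fderiv_apply isOpen_Ioo _)
    rw [lintegral_weight_sobolevEnergy_succ_slice isOpen_Ioo (hΘ.isSmoothSpaceTimeOn _),
      mul_add, Finset.mul_sum]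
    simp only [sobolevEnergy_succ]
    have hsplit : ∫⁻ s in Ioo 0 t, w s * ∑ i, ∑ j,
        ((∫⁻ x, ‖fderiv ℝ (fun y ↦ fderiv ℝ (heatDuhamelZero ν Θ s) y (bE i)) x (bE j)‖ₑ ^ 2) +
          ∑ l, sobolevEnergy k (fun x ↦ fderiv ℝ (fun z ↦ fderiv ℝ
            (fun y ↦ fderiv ℝ (heatDuhamelZero ν Θ s) y (bE i)) z (bE j)) x (bE l))) =
        (∫⁻ s in Ioo 0 t, w s * ∑ i, ∑ j, ∫⁻ x,
          ‖fderiv ℝ (fun y ↦ fderiv ℝ (heatDuhamelZero ν Θ s) y (bE i)) x (bE j)‖ₑ ^ 2) +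
          ∑ l, ∫⁻ s in Ioo 0 t, w s * ∑ i, ∑ j, sobolevEnergy k (fun x ↦ fderiv ℝ (fun z ↦ fderiv ℝ
            (fun y ↦ fderiv ℝ (heatDuhamelZero ν Θ s) y (bE i)) z (bE j)) x (bE l)) := by
      have hm1 : AEMeasurable (fun s ↦ w s * ∑ i, ∑ j, ∫⁻ x,
          ‖fderiv ℝ (fun y ↦ fderiv ℝ (heatDuhamelZero ν Θ s) y (bE i)) x (bE j)‖ₑ ^ 2)
          (volume.restrict (Ioo 0 t)) :=
        hwm.aemeasurable.mul (Finset.aemeasurable_fun_sum _ fun i _ ↦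
          Finset.aemeasurable_fun_sum _ fun j _ ↦ hmeas0 i j)
      have hm2 : ∀ l, AEMeasurable (fun s ↦ w s * ∑ i, ∑ j, sobolevEnergy k (fun x ↦ fderiv ℝ (fun z ↦ fderiv ℝ
          (fun y ↦ fderiv ℝ (heatDuhamelZero ν Θ s) y (bE i)) z (bE j)) x (bE l))) (volume.restrict (Ioo 0 t)) :=
        fun l ↦ hwm.aemeasurable.mul (Finset.aemeasurable_fun_sum _ fun i _ ↦
          Finset.aemeasurable_fun_sum _ fun j _ ↦ hmeask i j l)
      rw [← lintegral_finsetSum' _ fun l _ ↦ hm2 l, ← lintegral_add_left' hm1]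
      refine lintegral_congr fun s ↦ ?_
      rw [← Finset.mul_sum, ← mul_add]
      congr 1
      simp only [Finset.sum_add_distrib]
      congr 1
      symm
      rw [Finset.sum_comm]
      refine Finset.sum_congr rfl fun i _ ↦ ?_
      rw [Finset.sum_comm]
    rw [hsplit]
    refine add_le_add ?_ (Finset.sum_le_sum fun l _ ↦ ?_)
    · exact lintegral_weight_sum_enorm_sq_fderiv_fderiv_heatDuhamelZero_le hΘ hν hlam ht
    · -- `∂ₗ∂ⱼ∂ᵢv = ∂ⱼ∂ᵢ v[∂ₗΘ]`
      have heq : ∀ s i j, (fun x ↦ fderiv ℝ (fun z ↦ fderiv ℝ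
          (fun y ↦ fderiv ℝ (heatDuhamelZero ν Θ s) y (bE i)) z (bE j)) x (bE l)) =
          fun x ↦ fderiv ℝ (fun y ↦ fderiv ℝ
            (heatDuhamelZero ν (fun s y ↦ fderiv ℝ (Θ s) y (bE l)) s) y (bE i)) x (bE j) := by
        intro s i j
        have hva := isHeatAdmissible_heatDuhamelZero hΘ hν s
        -- move `∂ₗ` inside: `∂ₗ∂ⱼ(∂ᵢv) = ∂ⱼ∂ₗ(∂ᵢv)`, then `∂ₗ∂ᵢv = ∂ᵢ∂ₗv`, then `∂ₗv = v[∂ₗΘ]`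
        rw [(hva.fderiv_apply (bE i)).fderiv_fderiv_comm (bE j) (bE l)]
        have h2 : (fun z ↦ fderiv ℝ (fun y ↦ fderiv ℝ (heatDuhamelZero ν Θ s) y (bE i)) z (bE l)) =
            fun z ↦ fderiv ℝ (heatDuhamelZero ν (fun s y ↦ fderiv ℝ (Θ s) y (bE l)) s) z (bE i) := by
          rw [hva.fderiv_fderiv_comm (bE i) (bE l), fderiv_heatDuhamelZero_eq hΘ hν s (bE l)]
        rw [h2]
      simp only [heq]
      exact ih (hΘl l) ht

/-- **Weighted gradient at a time, every order**: `e^{-2λt}Σᵢ E_k(∂ᵢv(t)) ≤ (n/ν) ∫₀ᵗ e^{-2λs}E_k(Θ)`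
(`λ ≥ 0`). [cite: Evans2010, §7.1.2, Thm. 2] -/
theorem weight_mul_sum_sobolevEnergy_fderiv_heatDuhamelZero_le (hν : 0 < ν) {lam : ℝ} (hlam : 0 ≤ lam)
    (k : ℕ) :
    ∀ {Θ : ℝ → E → F'}, IsSpaceTimeTestOn (⊤ : Opens (ℝ × E)) Θ → ∀ {t : ℝ}, 0 ≤ t →
      ENNReal.ofReal (Real.exp (-2 * lam * t)) * ∑ i, sobolevEnergy k
          (fun x ↦ fderiv ℝ (heatDuhamelZero ν Θ t) x (stdOrthonormalBasis ℝ E i)) ≤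
        ENNReal.ofReal ((Module.finrank ℝ E : ℝ) / ν) *
          ∫⁻ s in Ioo 0 t, ENNReal.ofReal (Real.exp (-2 * lam * s)) * sobolevEnergy k (Θ s) := by
  induction k with
  | zero =>
    intro Θ hΘ t ht
    simp only [sobolevEnergy_zero_left]
    exact weight_mul_sum_lintegral_enorm_sq_fderiv_heatDuhamelZero_le hΘ hν hlam ht
  | succ k ih =>
    intro Θ hΘ t ht
    set bE := stdOrthonormalBasis ℝ E
    have hΘl : ∀ l, IsSpaceTimeTestOn (⊤ : Opens (ℝ × E)) (fun s y ↦ fderiv ℝ (Θ s) y (bE l)) :=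
      fun l ↦ hΘ.fderiv_apply_top _
    rw [lintegral_weight_sobolevEnergy_succ_slice isOpen_Ioo (hΘ.isSmoothSpaceTimeOn _)]
    conv_rhs => rw [mul_add, Finset.mul_sum]
    have hL : ENNReal.ofReal (Real.exp (-2 * lam * t)) * ∑ i, sobolevEnergy (k + 1)
        (fun x ↦ fderiv ℝ (heatDuhamelZero ν Θ t) x (bE i)) =
        ENNReal.ofReal (Real.exp (-2 * lam * t)) *
          (∑ i, ∫⁻ x, ‖fderiv ℝ (heatDuhamelZero ν Θ t) x (bE i)‖ₑ ^ 2) +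
          ∑ l, ENNReal.ofReal (Real.exp (-2 * lam * t)) * ∑ i, sobolevEnergy k
            (fun x ↦ fderiv ℝ (fun y ↦ fderiv ℝ (heatDuhamelZero ν Θ t) y (bE i)) x (bE l)) := by
      simp only [sobolevEnergy_succ]
      rw [Finset.sum_add_distrib, mul_add]
      congr 1
      rw [Finset.sum_comm, Finset.mul_sum]
    rw [hL]
    refine add_le_add ?_ (Finset.sum_le_sum fun l _ ↦ ?_)
    · exact weight_mul_sum_lintegral_enorm_sq_fderiv_heatDuhamelZero_le hΘ hν hlam ht
    · have heq : ∀ i, (fun x ↦ fderiv ℝ (fun y ↦ fderiv ℝ (heatDuhamelZero ν Θ t) y (bE i)) x (bE l)) =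
          fun x ↦ fderiv ℝ (heatDuhamelZero ν (fun s y ↦ fderiv ℝ (Θ s) y (bE l)) t) x (bE i) := by
        intro i
        rw [(isHeatAdmissible_heatDuhamelZero hΘ hν t).fderiv_fderiv_comm (bE i) (bE l),
          fderiv_heatDuhamelZero_eq hΘ hν t (bE l)]
      simp only [heq]
      exact ih (hΘl l) ht

end AllOrders

/-! ### Smoothness up to the initial time -/

section Slab

/-- **`v = heatDuhamelZero ν Θ` is smooth up to the initial time**: `C^∞` on `[0, ∞) ×ˢ univ`
in the within sense (`𝒱` is smooth on `ℝ × E`, the free flow of the admissible datum `𝒱(0)`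
is smooth up to `t = 0` by `contDiffOn_uncurry_freeFlow`). [cite: Evans2010, §2.3.1, Thm. 2] -/
theorem contDiffOn_uncurry_heatDuhamelZero (hΘ : IsSpaceTimeTestOn (⊤ : Opens (ℝ × E)) Θ)
    (hν : 0 < ν) : ContDiffOn ℝ ∞ (uncurry (heatDuhamelZero ν Θ)) (Ici 0 ×ˢ univ) := by
  haveI : CompleteSpace F' := FiniteDimensional.complete ℝ F'
  have h1 : ContDiffOn ℝ ∞ (uncurry (heatDuhamelFwd ν Θ)) (Ici 0 ×ˢ univ) :=
    (contDiff_uncurry_heatDuhamelFwd hΘ hν).contDiffOn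
  have h2 := contDiffOn_uncurry_freeFlow (isHeatAdmissible_heatDuhamelFwd hν hΘ 0) hν
  exact h1.sub h2

/-- The same in `IsSmoothSpaceTimeOn` form, on `[0, ∞)` and on every `[0, T]`.
[cite: Evans2010, §2.3.1, Thm. 2] -/
theorem isSmoothSpaceTimeOn_heatDuhamelZero_Ici (hΘ : IsSpaceTimeTestOn (⊤ : Opens (ℝ × E)) Θ)
    (hν : 0 < ν) : IsSmoothSpaceTimeOn (Ici 0) (heatDuhamelZero ν Θ) :=
  contDiffOn_uncurry_heatDuhamelZero hΘ hν

/-- On `[0, T]`. [cite: Evans2010, §2.3.1, Thm. 2] -/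
theorem isSmoothSpaceTimeOn_heatDuhamelZero_Icc (hΘ : IsSpaceTimeTestOn (⊤ : Opens (ℝ × E)) Θ)
    (hν : 0 < ν) (T : ℝ) : IsSmoothSpaceTimeOn (Icc 0 T) (heatDuhamelZero ν Θ) :=
  (isSmoothSpaceTimeOn_heatDuhamelZero_Ici hΘ hν).mono Icc_subset_Ici_self

end Slab

end Literature.Analysis.PDE

end
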